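import Literature.NumberTheory.LFunctions.SatheSelbergRieszMeans
import Literature.NumberTheory.LFunctions.SatheSelbergFromSelbergDelange
import Literature.NumberTheory.LFunctions.SelbergDelangeTheoremProofs
import Literature.Analysis.Complex.KeyholeHankel
import HarnessLib

/-!
# Selberg's mean value of `z^{ω(n)}` and the Sathe–Selberg formula (MV §7.4.1 Exercise 3(c)) — proofs

Topic `NumberTheory/LFunctions`. Everything in this file is PROVED (theorems only, no definitions,
no named facts). It discharges the named fact
`Literature.NumberTheory.LFunctions.MontgomeryVaughan2007_exercise_7_4_3c` (`SatheSelberg.lean`: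
the local laws `ρ_k(x) = G((k−1)/log log x) x (log log x)^{k−1}/((k−1)! log x)(1 + O_R(k/(log log x)²))`
for the integers with exactly `k` distinct prime factors, Montgomery–Vaughan, *Multiplicative
Number Theory I*, §7.4.1 Exercise 3(c); Selberg 1954) as
`MontgomeryVaughan2007_exercise_7_4_3c_holds'` (primed: an independent proof of the same fact,
`MontgomeryVaughan2007_exercise_7_4_3c_holds`, lives in `SatheSelbergSmoothedProof.lean`).

## The argument

The tree already contains, all PROVED:

* the passage "mean value of `z^{ω(n)}` ⇒ local laws" (the Cauchy-integral/saddle-point argument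
  of MV p. 180): `MontgomeryVaughan2007_exercise_7_4_3c_of_omegaMeanValue`
  (`SatheSelbergProofs.lean`), whose hypothesis `hmv` is Selberg's mean value formula
  `Σ_{n ≤ x} z^{ω(n)} = F_x(z)/Γ(z) · x (log x)^{z−1} + O_R(x (log x)^{Re z − 2})` (`x ≥ 2`, `‖z‖ ≤ R`);
* the Selberg–Delange CONTOUR MACHINERY for the continued integrand
  `Ψ_y(s) = y^{1+s} F(s,z) ζ(s)^z/(s(s+1))` of the Riesz means `I_z(y) = Σ_{n ≤ y} z^{ω(n)}(y − n)`
  (MV pp. 177–178 for `ω`): Perron's formula of order one, the keyhole deformation inside the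
  classical zero-free region and the bounds for the tails, the left side and the horizontal sides
  (`SatheSelbergRieszMeans.lean`), the keyhole engine reducing `(s−1)^{−z}𝒢(s)x^{1+s}` to truncated
  Hankel loops to any order (`KeyholeHankel.lean`) and Hankel's formula (`HankelLoopIntegral.lean`).

What the printed proof of Theorem 7.17 does with the TRUNCATED Perron formula (Corollary 5.3 and the
short-interval estimates for `d_R(n)` by the hyperbola method, p. 177) is replaced here by a
de-smoothing of the Riesz means through an AVERAGED difference, which needs only a crude
short-interval bound: with `x = e^L`, `h = ηx`, `η = e^{−(c̄/4)√L}`,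

  `Σ_{n ≤ x} z^{ω(n)} = (I_z(x+h) − I_z(x))/h − h⁻¹ Σ_{x < n ≤ x+h} z^{ω(n)} (x + h − n)`.

Both Riesz means are deformed onto the SAME keyhole contour attached to `L`; the far pieces are
`O(x² L^R e^{−c̄√L})` (so dividing by `h` is harmless), the difference of the two keyhole integrals
is `η · [keyhole of (s−1)^{−z} 𝒢₀(s) x^{1+s}] + O(η² x² L^{Re z−1})` with `𝒢₀ = F e^{z logZeta₁}/s`
(since `(x+h)^{1+s} − x^{1+s} = x^{1+s}((1+s)η + O(η²))`), whose Taylor expansion on the keyhole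
gives the main term `η F(1,z) x² (log x)^{z−1} · 2πi/Γ(z)` and `O(η x² L^{Re z−2})`; and the short
sum is `O((h + √x)(log x)^{k})` by the elementary bound
`Σ_{X<n≤Y} A^{ω(n)} ≤ A (Y − X + √Y)(1 + log √Y)^k` (`k ≥ A²`: every `n` has a divisor `d ≤ √n` with
`ω(n) ≤ 2ω(d) + 1`, `A^{2ω} ≤ τ_k`, `Σ_{d ≤ D} τ_k(d)/d ≤ H_D^k`). This proves the hypothesis `hmv`
(`SatheSelberg.omegaMeanValue`; the finitely many small `x` are settled by compactness in `z`), and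
hence the named fact. In particular the Sathe–Selberg formula no longer depends on the unproved
general facts `MontgomeryVaughan2007_thm_7_17/7_18` (`SelbergDelangeTheorem.lean`), of which it was
shown to be a consequence in `SatheSelbergFromSelbergDelange.lean`.

## Main results

* `SatheSelberg.sum_Ioc_pow_cardDistinctFactors_le` — the crude short-interval bound for `A^{ω(n)}`;
* `SatheSelberg.exists_norm_line_sub_keyhole_le` — the far pieces of the contour, base `y` decoupled
  from the contour parameter `L`;
* `SatheSelberg.exists_norm_keyhole_diff_le` — the keyhole integral of `Ψ_{(1+η)x} − Ψ_x`;
* `SatheSelberg.omegaCoeff_sum_asymp` — **Selberg's mean value of `z^{ω(n)}`**, plain partial sums,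
  `x = e^L`, main term `F(1,z)Γ(z)⁻¹ x L^{z−1}`;
* `SatheSelberg.omegaMeanValue` — the same at integers `x ≥ 2` with the finite Euler product `F_x`;
* `MontgomeryVaughan2007_exercise_7_4_3c_holds'`.

## References

* [MontgomeryVaughan2007] H. L. Montgomery, R. C. Vaughan, *Multiplicative Number Theory I.
  Classical Theory*, Cambridge Stud. Adv. Math. 97 (2007), §7.4, Theorems 7.17–7.19 and their
  proofs (pp. 177–181), §7.4.1 Exercise 3 (p. 182). doi:10.1017/CBO9780511618314
* [Selberg1954] A. Selberg, *Note on a paper by L. G. Sathe*, J. Indian Math. Soc. (N.S.) 18 (1954)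
  83–87.
* [Tenenbaum2015] G. Tenenbaum, *Introduction to Analytic and Probabilistic Number Theory*, 3rd ed.,
  GSM 163 (AMS 2015), II.5 (the Selberg–Delange method).
-/

noncomputable section

open Complex Set MeasureTheory Filter Topology Metric intervalIntegral
open scoped Real Interval Nat ArithmeticFunction.omega

namespace Literature.NumberTheory.LFunctions

namespace SatheSelberg

open ClassicalPsiData (kernel)
open Literature.Analysis.Complex.Keyhole (keyhole hankelLoop onKeyhole)


section ShortInterval

open Finset ArithmeticFunction
open scoped ArithmeticFunction.zeta

/-! ### The generalized divisor functions `τ_k = ζ^k` -/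

/-- `τ_{k+1}(n) = Σ_{d | n} τ_k(d)`. [folklore] -/
theorem zeta_pow_succ_apply (k n : ℕ) :
    ((ζ : ArithmeticFunction ℕ) ^ (k + 1)) n = ∑ d ∈ n.divisors, ((ζ : ArithmeticFunction ℕ) ^ k) d := by
  rw [pow_succ', ArithmeticFunction.zeta_mul_apply]

/-- `τ_k` is multiplicative. [folklore] -/
theorem isMultiplicative_zeta_pow (k : ℕ) : ((ζ : ArithmeticFunction ℕ) ^ k).IsMultiplicative := by
  induction k with
  | zero => rw [pow_zero]; exact isMultiplicative_one
  | succ k ih => rw [pow_succ]; exact ih.mul isMultiplicative_zeta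

/-- `τ_k(1) = 1`. [folklore] -/
theorem zeta_pow_apply_one (k : ℕ) : ((ζ : ArithmeticFunction ℕ) ^ k) 1 = 1 :=
  (isMultiplicative_zeta_pow k).map_one

/-- `τ_k(n) ≥ 1` for `n, k ≥ 1`. [folklore] -/
theorem one_le_zeta_pow_apply {k n : ℕ} (hk : 1 ≤ k) (hn : 1 ≤ n) :
    1 ≤ ((ζ : ArithmeticFunction ℕ) ^ k) n := by
  induction k, hk using Nat.le_induction with
  | base => rw [pow_one, zeta_apply_ne (by omega)]
  | succ k hk ih =>
    rw [zeta_pow_succ_apply]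
    calc 1 ≤ ((ζ : ArithmeticFunction ℕ) ^ k) n := ih
      _ ≤ ∑ d ∈ n.divisors, ((ζ : ArithmeticFunction ℕ) ^ k) d :=
          Finset.single_le_sum (fun d _ => Nat.zero_le _) (Nat.mem_divisors_self n (by omega))

/-- `τ_k(n) ≥ k` for `n ≥ 2`, `k ≥ 1`. [folklore] -/
theorem le_zeta_pow_apply {k n : ℕ} (hk : 1 ≤ k) (hn : 2 ≤ n) :
    k ≤ ((ζ : ArithmeticFunction ℕ) ^ k) n := by
  induction k, hk using Nat.le_induction with
  | base => rw [pow_one, zeta_apply_ne (by omega)]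
  | succ k hk ih =>
    rw [zeta_pow_succ_apply]
    have h1 : (1 : ℕ) ∈ n.divisors := Nat.one_mem_divisors.2 (by omega)
    have hn' : n ∈ n.divisors := Nat.mem_divisors_self n (by omega)
    have hsub : ({1, n} : Finset ℕ) ⊆ n.divisors := by
      intro d hd
      rcases Finset.mem_insert.1 hd with rfl | hd
      · exact h1
      · rw [Finset.mem_singleton.1 hd]; exact hn'
    calc k + 1 = 1 + k := by ring
      _ ≤ ((ζ : ArithmeticFunction ℕ) ^ k) 1 + ((ζ : ArithmeticFunction ℕ) ^ k) n := by
          rw [zeta_pow_apply_one]; exact Nat.add_le_add_left ih 1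
      _ = ∑ d ∈ ({1, n} : Finset ℕ), ((ζ : ArithmeticFunction ℕ) ^ k) d := by
          rw [Finset.sum_pair (by omega)]
      _ ≤ ∑ d ∈ n.divisors, ((ζ : ArithmeticFunction ℕ) ^ k) d :=
          Finset.sum_le_sum_of_subset_of_nonneg hsub fun _ _ _ => Nat.zero_le _

/-- `B^{ω(n)} ≤ τ_k(n)` for `n ≥ 1`, `0 ≤ B ≤ k`, `k ≥ 1`. [folklore] -/
theorem pow_cardDistinctFactors_le_zeta_pow {B : ℝ} {k : ℕ} (hB : 0 ≤ B) (hBk : B ≤ k) (hk : 1 ≤ k)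
    {n : ℕ} (hn : 1 ≤ n) :
    B ^ (ω n) ≤ (((ζ : ArithmeticFunction ℕ) ^ k) n : ℝ) := by
  induction n using Nat.recOnPosPrimePosCoprime with
  | prime_pow p a hp ha =>
    rw [cardDistinctFactors_apply_prime_pow hp (by omega), pow_one]
    have h2 : 2 ≤ p ^ a := by
      calc 2 ≤ p := hp.two_le
        _ = p ^ 1 := (pow_one p).symm
        _ ≤ p ^ a := Nat.pow_le_pow_right hp.pos ha
    calc B ≤ k := hBk
      _ ≤ (((ζ : ArithmeticFunction ℕ) ^ k) (p ^ a) : ℝ) := by exact_mod_cast le_zeta_pow_apply hk h2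
  | zero => omega
  | one =>
    rw [cardDistinctFactors_one, pow_zero, zeta_pow_apply_one]; simp
  | coprime m n hm hn' hmn ihm ihn =>
    rw [cardDistinctFactors_mul hmn, pow_add, (isMultiplicative_zeta_pow k).map_mul_of_coprime hmn,
      Nat.cast_mul]
    exact mul_le_mul (ihm (by omega)) (ihn (by omega)) (pow_nonneg hB _)
      ((pow_nonneg hB _).trans (ihm (by omega)))

/-- **`Σ_{d ≤ D} τ_k(d)/d ≤ H_D^k`** (`H_D = Σ_{m ≤ D} 1/m`), by `τ_{k+1} = ζ * τ_k` and Dirichlet's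
interchange. [folklore] -/
theorem sum_zeta_pow_div_le (k D : ℕ) (hD : 1 ≤ D) :
    ∑ d ∈ Finset.Icc 1 D, (((ζ : ArithmeticFunction ℕ) ^ k) d : ℝ) / d ≤
      (∑ m ∈ Finset.Icc 1 D, (1 : ℝ) / m) ^ k := by
  induction k with
  | zero =>
    rw [pow_zero, pow_zero]
    have h : ∀ d ∈ Finset.Icc 1 D, (((1 : ArithmeticFunction ℕ)) d : ℝ) / d = if d = 1 then 1 else 0 := by
      intro d hd
      rw [ArithmeticFunction.one_apply]
      split_ifs with h
      · subst h; simp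
      · simp
    rw [Finset.sum_congr rfl h, Finset.sum_ite_eq']
    simp [hD]
  | succ k ih =>
    have hH : 0 ≤ ∑ m ∈ Finset.Icc 1 D, (1 : ℝ) / m :=
      Finset.sum_nonneg fun m _ => by positivity
    -- `Σ_{d ≤ D} τ_{k+1}(d)/d = Σ_{m ≤ D} τ_k(m)/m · Σ_{e ≤ D/m} 1/e`
    have hstep : ∑ d ∈ Finset.Icc 1 D, (((ζ : ArithmeticFunction ℕ) ^ (k + 1)) d : ℝ) / d =
        ∑ m ∈ Finset.Icc 1 D, (((ζ : ArithmeticFunction ℕ) ^ k) m : ℝ) / m *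
          ∑ e ∈ Finset.Icc 1 (D / m), (1 : ℝ) / e := by
      have h1 : ∀ d ∈ Finset.Icc 1 D, (((ζ : ArithmeticFunction ℕ) ^ (k + 1)) d : ℝ) / d =
          ∑ m ∈ d.divisors, (((ζ : ArithmeticFunction ℕ) ^ k) m : ℝ) / m * (1 / ((d / m : ℕ) : ℝ)) := by
        intro d hd
        rw [zeta_pow_succ_apply, Nat.cast_sum, Finset.sum_div]
        refine Finset.sum_congr rfl fun m hm => ?_
        have hmd : m ∣ d := Nat.dvd_of_mem_divisors hm
        have hm0 : 0 < m := Nat.pos_of_mem_divisors hm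
        have hd0 : d ≠ 0 := (Nat.mem_divisors.1 hm).2
        obtain ⟨e, rfl⟩ := hmd
        have he0 : e ≠ 0 := by rintro rfl; simp at hd0
        rw [Nat.mul_div_cancel_left e hm0, Nat.cast_mul]
        field_simp
      rw [Finset.sum_congr rfl h1,
        SelbergDelange.sum_Icc_sum_divisors_eq D
          (fun m e => (((ζ : ArithmeticFunction ℕ) ^ k) m : ℝ) / m * (1 / (e : ℝ)))]
      refine Finset.sum_congr rfl fun m _ => ?_
      rw [Finset.mul_sum]
    rw [hstep, pow_succ]
    calc ∑ m ∈ Finset.Icc 1 D, (((ζ : ArithmeticFunction ℕ) ^ k) m : ℝ) / m *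
          ∑ e ∈ Finset.Icc 1 (D / m), (1 : ℝ) / e
        ≤ ∑ m ∈ Finset.Icc 1 D, (((ζ : ArithmeticFunction ℕ) ^ k) m : ℝ) / m *
          ∑ e ∈ Finset.Icc 1 D, (1 : ℝ) / e := by
          refine Finset.sum_le_sum fun m hm => ?_
          refine mul_le_mul_of_nonneg_left ?_ (by positivity)
          refine Finset.sum_le_sum_of_subset_of_nonneg (Finset.Icc_subset_Icc_right
            (Nat.div_le_self D m)) fun _ _ _ => by positivity
      _ = (∑ m ∈ Finset.Icc 1 D, (((ζ : ArithmeticFunction ℕ) ^ k) m : ℝ) / m) *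
          ∑ e ∈ Finset.Icc 1 D, (1 : ℝ) / e := (Finset.sum_mul _ _ _).symm
      _ ≤ (∑ m ∈ Finset.Icc 1 D, (1 : ℝ) / m) ^ k * ∑ e ∈ Finset.Icc 1 D, (1 : ℝ) / e :=
          mul_le_mul_of_nonneg_right ih hH

/-- `H_D ≤ 1 + log D` (Mathlib's `harmonic_le_one_add_log`). [folklore] -/
theorem sum_Icc_one_div_le_one_add_log (D : ℕ) :
    ∑ m ∈ Finset.Icc 1 D, (1 : ℝ) / m ≤ 1 + Real.log D := by
  have h := harmonic_le_one_add_log D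
  have e : (harmonic D : ℝ) = ∑ m ∈ Finset.Icc 1 D, (1 : ℝ) / m := by
    rw [harmonic_eq_sum_Icc, Rat.cast_sum]
    refine Finset.sum_congr rfl fun m _ => ?_
    simp
  rwa [e] at h

/-! ### A divisor `d ∣ n` with `d² ≤ n` carrying half of `ω(n)` -/

/-- The inductive step: if `p ≠ q` are primes dividing `n` with `p^{v_p(n)} ≤ q^{v_q(n)}`, and the
claim holds below `n`, then it holds for `n`. [folklore] -/
theorem exists_dvd_sq_le_aux {n : ℕ} (hn : 1 ≤ n) {p q : ℕ} (hp : p.Prime) (hq : q.Prime) (hpq : p ≠ q)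
    (hpn : p ∣ n) (hqn : q ∣ n) (hPQ : ordProj[p] n ≤ ordProj[q] n)
    (ih : ∀ m < n, 1 ≤ m → ∃ d, d ∣ m ∧ d * d ≤ m ∧ ω m ≤ 2 * ω d + 1) :
    ∃ d, d ∣ n ∧ d * d ≤ n ∧ ω n ≤ 2 * ω d + 1 := by
  have hn0 : n ≠ 0 := by omega
  set P : ℕ := ordProj[p] n with hP
  set n₁ : ℕ := ordCompl[p] n with hn₁
  have hn₁0 : n₁ ≠ 0 := (Nat.ordCompl_pos p (by omega)).ne'
  have hPn₁ : P * n₁ = n := Nat.ordProj_mul_ordCompl_eq_self n p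
  have hcop₁ : Nat.Coprime p n₁ := Nat.coprime_ordCompl hp hn0
  have ha : 1 ≤ n.factorization p := by
    rwa [← hp.dvd_iff_one_le_factorization hn0]
  -- `q ∣ n₁`
  have hqP : ¬ q ∣ P := by
    intro h
    have := (Nat.prime_dvd_prime_iff_eq hq hp).1 (hq.dvd_of_dvd_pow h)
    exact hpq this.symm
  have hqn₁ : q ∣ n₁ := by
    have h : q ∣ P * n₁ := by rwa [hPn₁]
    exact ((Nat.Prime.dvd_mul hq).1 h).resolve_left hqP
  set Q : ℕ := ordProj[q] n₁ with hQ
  set m : ℕ := ordCompl[q] n₁ with hm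
  have hm0 : m ≠ 0 := (Nat.ordCompl_pos q hn₁0).ne'
  have hQm : Q * m = n₁ := Nat.ordProj_mul_ordCompl_eq_self n₁ q
  have hcop₂ : Nat.Coprime q m := Nat.coprime_ordCompl hq hn₁0
  have hb : 1 ≤ n₁.factorization q := by
    rwa [← hq.dvd_iff_one_le_factorization hn₁0]
  -- `Q = ordProj[q] n`
  have hQn : Q = ordProj[q] n := by
    rw [hQ, hn₁, Nat.factorization_ordCompl n p]
    simp [Finsupp.erase_ne hpq.symm]
  have hPQ' : P ≤ Q := by rwa [hQn]
  have hP2 : 2 ≤ P := by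
    calc 2 ≤ p := hp.two_le
      _ = p ^ 1 := (pow_one p).symm
      _ ≤ P := Nat.pow_le_pow_right hp.pos ha
  have hQ2 : 2 ≤ Q := by
    calc 2 ≤ q := hq.two_le
      _ = q ^ 1 := (pow_one q).symm
      _ ≤ Q := Nat.pow_le_pow_right hq.pos hb
  -- `m < n`
  have hmn : m < n := by
    have h1 : m < Q * m := by
      calc m = 1 * m := (one_mul m).symm
        _ < Q * m := Nat.mul_lt_mul_of_pos_right (by omega) (Nat.pos_of_ne_zero hm0)
    calc m < Q * m := h1
      _ = n₁ := hQm
      _ = 1 * n₁ := (one_mul _).symm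
      _ ≤ P * n₁ := Nat.mul_le_mul_right _ (by omega)
      _ = n := hPn₁
  obtain ⟨d', hd'm, hd'sq, hωm⟩ := ih m hmn (Nat.one_le_iff_ne_zero.2 hm0)
  -- coprimality of `d'` with `p`
  have hd'n₁ : d' ∣ n₁ := hd'm.trans ⟨Q, by rw [mul_comm, hQm]⟩
  have hcopd' : Nat.Coprime d' P := by
    have h1 : Nat.Coprime n₁ p := hcop₁.symm
    have h2 : Nat.Coprime d' p := Nat.Coprime.coprime_dvd_left hd'n₁ h1
    exact Nat.Coprime.pow_right _ h2
  have hd'0 : d' ≠ 0 := by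
    rintro rfl
    rw [zero_dvd_iff] at hd'm
    exact hm0 hd'm
  refine ⟨d' * P, ?_, ?_, ?_⟩
  · -- `d' P ∣ n = P (Q m)`
    rw [← hPn₁, ← hQm]
    calc d' * P ∣ m * P := Nat.mul_dvd_mul_right hd'm P
      _ ∣ P * (Q * m) := ⟨Q, by ring⟩
  · calc d' * P * (d' * P) = (d' * d') * (P * P) := by ring
      _ ≤ m * (P * Q) := Nat.mul_le_mul hd'sq (Nat.mul_le_mul_left P hPQ')
      _ = P * (Q * m) := by ring
      _ = n := by rw [hQm, hPn₁]
  · -- `ω(n) = 2 + ω(m)`, `ω(d' P) = ω(d') + 1`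
    have hωP : ω P = 1 := by
      rw [hP, cardDistinctFactors_apply_prime_pow hp (by omega)]
    have hωQ : ω Q = 1 := by
      rw [hQ, cardDistinctFactors_apply_prime_pow hq (by omega)]
    have hcopPn₁ : Nat.Coprime P n₁ := Nat.Coprime.pow_left _ hcop₁
    have hcopQm : Nat.Coprime Q m := Nat.Coprime.pow_left _ hcop₂
    have hωn : ω n = 2 + ω m := by
      rw [← hPn₁, cardDistinctFactors_mul hcopPn₁, ← hQm, cardDistinctFactors_mul hcopQm, hωP, hωQ]
      ring
    have hωd : ω (d' * P) = ω d' + 1 := by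
      rw [cardDistinctFactors_mul hcopd', hωP]
    rw [hωn, hωd]
    omega

/-- **Every `n ≥ 1` has a divisor `d` with `d² ≤ n` and `ω(n) ≤ 2 ω(d) + 1`** (take the smaller
half of the prime-power components). [folklore] -/
theorem exists_dvd_sq_le (n : ℕ) (hn : 1 ≤ n) : ∃ d, d ∣ n ∧ d * d ≤ n ∧ ω n ≤ 2 * ω d + 1 := by
  induction n using Nat.strong_induction_on with
  | _ n ih =>
    by_cases hω : ω n ≤ 1
    · exact ⟨1, one_dvd n, by simpa using hn, by simp; omega⟩
    · -- two distinct prime factors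
      push Not at hω
      have hcard : 1 < n.primeFactors.card := by
        have e : ω n = n.primeFactors.card := by
          rw [cardDistinctFactors_apply, ← List.card_toFinset, Nat.toFinset_factors]
        rwa [← e]
      obtain ⟨p, hp, q, hq, hpq⟩ := Finset.one_lt_card.1 hcard
      have hp' := Nat.prime_of_mem_primeFactors hp
      have hq' := Nat.prime_of_mem_primeFactors hq
      have hpn := Nat.dvd_of_mem_primeFactors hp
      have hqn := Nat.dvd_of_mem_primeFactors hq
      rcases le_total (ordProj[p] n) (ordProj[q] n) with h | h
      · exact exists_dvd_sq_le_aux hn hp' hq' hpq hpn hqn h ih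
      · exact exists_dvd_sq_le_aux hn hq' hp' (Ne.symm hpq) hqn hpn h ih

/-! ### The short-interval bound -/

/-- Counting multiples of `d ≥ 1` in `(X, Y]`: at most `(Y − X)/d + 1`. [folklore] -/
theorem card_Ioc_filter_dvd_le {d : ℕ} (hd : 1 ≤ d) (X Y : ℕ) (hXY : X ≤ Y) :
    ((Finset.Ioc X Y).filter (d ∣ ·)).card ≤ (Y - X) / d + 1 := by
  have hY : ((Finset.Ioc 0 Y).filter (d ∣ ·)).card = Y / d := Nat.Ioc_filter_dvd_card_eq_div Y d
  have hX : ((Finset.Ioc 0 X).filter (d ∣ ·)).card = X / d := Nat.Ioc_filter_dvd_card_eq_div X d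
  have hsplit : (Finset.Ioc 0 Y).filter (d ∣ ·) =
      (Finset.Ioc 0 X).filter (d ∣ ·) ∪ (Finset.Ioc X Y).filter (d ∣ ·) := by
    rw [← Finset.filter_union, Finset.Ioc_union_Ioc_eq_Ioc (Nat.zero_le X) hXY]
  have hdisj : Disjoint ((Finset.Ioc 0 X).filter (d ∣ ·)) ((Finset.Ioc X Y).filter (d ∣ ·)) := by
    refine Finset.disjoint_filter_filter ?_
    exact Finset.Ioc_disjoint_Ioc_of_le le_rfl
  have hcard : Y / d = X / d + ((Finset.Ioc X Y).filter (d ∣ ·)).card := by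
    rw [← hY, hsplit, Finset.card_union_of_disjoint hdisj, hX]
  have hYX : Y = (Y - X) + X := by omega
  have hdiv : Y / d ≤ (Y - X) / d + X / d + 1 := by
    conv_lhs => rw [hYX]
    rw [Nat.add_div (by omega)]
    split_ifs <;> omega
  omega

/-- **Crude short-interval bound for `A^{ω(n)}`**: for `A ≥ 1`, `A² ≤ k` and `X ≤ Y`,
`Σ_{X < n ≤ Y} A^{ω(n)} ≤ A ((Y − X) + √Y) (1 + log √Y)^k` (with `√Y = Nat.sqrt Y`): every `n` has a
divisor `d ≤ √n` with `A^{ω(n)} ≤ A (A²)^{ω(d)} ≤ A τ_k(d)`, each `d ≤ √Y` has at most `(Y−X)/d + 1`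
multiples in `(X, Y]`, and `Σ_{d ≤ D} τ_k(d)/d ≤ (1 + log D)^k`. [folklore] -/
theorem sum_Ioc_pow_cardDistinctFactors_le {A : ℝ} (hA : 1 ≤ A) {k : ℕ} (hk : A ^ 2 ≤ k) {X Y : ℕ}
    (hXY : X ≤ Y) :
    ∑ n ∈ Finset.Ioc X Y, A ^ (ω n) ≤
      A * (((Y - X : ℕ) : ℝ) + Nat.sqrt Y) * (1 + Real.log (Nat.sqrt Y)) ^ k := by
  rcases Nat.eq_zero_or_pos Y with hY0 | hY0
  · subst hY0
    have hX0 : X = 0 := by omega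
    subst hX0
    simp
  have hA0 : 0 ≤ A := by linarith
  have hk1 : 1 ≤ k := by
    have : (1 : ℝ) ≤ k := le_trans (by nlinarith) hk
    exact_mod_cast this
  set D : ℕ := Nat.sqrt Y with hDdef
  have hD1 : 1 ≤ D := by rw [hDdef, Nat.le_sqrt]; omega
  set τ : ℕ → ℝ := fun d => (((ζ : ArithmeticFunction ℕ) ^ k) d : ℝ) with hτ
  have hτ0 : ∀ d, 0 ≤ τ d := fun d => by positivity
  -- Step 1: pointwise `A^{ω(n)} ≤ A Σ_{d ∈ Icc 1 D, d ∣ n} τ(d)` for `n ∈ (X, Y]`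
  have hpt : ∀ n ∈ Finset.Ioc X Y,
      A ^ (ω n) ≤ A * ∑ d ∈ (Finset.Icc 1 D).filter (· ∣ n), τ d := by
    intro n hn
    have hn' := Finset.mem_Ioc.1 hn
    have hn1 : 1 ≤ n := by omega
    obtain ⟨d, hdn, hdd, hω⟩ := exists_dvd_sq_le n hn1
    have hd1 : 1 ≤ d := Nat.pos_of_dvd_of_pos hdn (by omega)
    have hdD : d ∈ (Finset.Icc 1 D).filter (· ∣ n) := by
      refine Finset.mem_filter.2 ⟨Finset.mem_Icc.2 ⟨hd1, ?_⟩, hdn⟩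
      rw [hDdef, Nat.le_sqrt]
      exact hdd.trans hn'.2
    have h1 : A ^ (ω n) ≤ A * (A ^ 2) ^ (ω d) := by
      calc A ^ (ω n) ≤ A ^ (2 * ω d + 1) := pow_le_pow_right₀ hA hω
        _ = A * (A ^ 2) ^ (ω d) := by rw [pow_succ, pow_mul]; ring
    have h2 : (A ^ 2) ^ (ω d) ≤ τ d :=
      pow_cardDistinctFactors_le_zeta_pow (by positivity) hk hk1 hd1
    calc A ^ (ω n) ≤ A * (A ^ 2) ^ (ω d) := h1
      _ ≤ A * τ d := mul_le_mul_of_nonneg_left h2 hA0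
      _ ≤ A * ∑ d ∈ (Finset.Icc 1 D).filter (· ∣ n), τ d :=
          mul_le_mul_of_nonneg_left (Finset.single_le_sum (fun d _ => hτ0 d) hdD) hA0
  -- Step 2: interchange
  have hinter : ∑ n ∈ Finset.Ioc X Y, ∑ d ∈ (Finset.Icc 1 D).filter (· ∣ n), τ d =
      ∑ d ∈ Finset.Icc 1 D, τ d * (((Finset.Ioc X Y).filter (d ∣ ·)).card : ℝ) := by
    rw [Finset.sum_comm' (t' := Finset.Icc 1 D) (s' := fun d => (Finset.Ioc X Y).filter (d ∣ ·))]
    · refine Finset.sum_congr rfl fun d _ => ?_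
      rw [Finset.sum_const, nsmul_eq_mul, mul_comm]
    · intro n d
      simp only [Finset.mem_filter]
      tauto
  -- Step 3: bound the counts and sum up
  have hS : ∑ d ∈ Finset.Icc 1 D, τ d / d ≤ (1 + Real.log D) ^ k := by
    calc ∑ d ∈ Finset.Icc 1 D, τ d / d ≤ (∑ m ∈ Finset.Icc 1 D, (1 : ℝ) / m) ^ k :=
          sum_zeta_pow_div_le k D hD1
      _ ≤ (1 + Real.log D) ^ k := by
          refine pow_le_pow_left₀ (Finset.sum_nonneg fun m _ => by positivity) ?_ k
          exact sum_Icc_one_div_le_one_add_log D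
  have hlog0 : 0 ≤ 1 + Real.log D := by
    have : 0 ≤ Real.log D := Real.log_nonneg (by exact_mod_cast hD1)
    linarith
  calc ∑ n ∈ Finset.Ioc X Y, A ^ (ω n)
      ≤ ∑ n ∈ Finset.Ioc X Y, A * ∑ d ∈ (Finset.Icc 1 D).filter (· ∣ n), τ d := Finset.sum_le_sum hpt
    _ = A * ∑ d ∈ Finset.Icc 1 D, τ d * (((Finset.Ioc X Y).filter (d ∣ ·)).card : ℝ) := by
        rw [← Finset.mul_sum, hinter]
    _ ≤ A * ∑ d ∈ Finset.Icc 1 D, τ d * (((Y - X : ℕ) : ℝ) / d + 1) := by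
        refine mul_le_mul_of_nonneg_left (Finset.sum_le_sum fun d hd => ?_) hA0
        have hd1 : 1 ≤ d := (Finset.mem_Icc.1 hd).1
        refine mul_le_mul_of_nonneg_left ?_ (hτ0 d)
        have h := card_Ioc_filter_dvd_le hd1 X Y hXY
        calc (((Finset.Ioc X Y).filter (d ∣ ·)).card : ℝ) ≤ (((Y - X) / d + 1 : ℕ) : ℝ) := by
              exact_mod_cast h
          _ = (((Y - X) / d : ℕ) : ℝ) + 1 := by push_cast; ring
          _ ≤ ((Y - X : ℕ) : ℝ) / d + 1 := by
              gcongr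
              exact Nat.cast_div_le
    _ = A * ((((Y - X : ℕ) : ℝ)) * ∑ d ∈ Finset.Icc 1 D, τ d / d + ∑ d ∈ Finset.Icc 1 D, τ d) := by
        congr 1
        rw [Finset.mul_sum, ← Finset.sum_add_distrib]
        refine Finset.sum_congr rfl fun d _ => ?_
        ring
    _ ≤ A * ((((Y - X : ℕ) : ℝ)) * ∑ d ∈ Finset.Icc 1 D, τ d / d + D * ∑ d ∈ Finset.Icc 1 D, τ d / d) := by
        gcongr
        rw [Finset.mul_sum]
        refine Finset.sum_le_sum fun d hd => ?_
        have hd' := Finset.mem_Icc.1 hd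
        have hd0 : (0 : ℝ) < d := by exact_mod_cast hd'.1
        have hdD : (d : ℝ) ≤ D := by exact_mod_cast hd'.2
        calc τ d = d * (τ d / d) := by field_simp
          _ ≤ D * (τ d / d) := mul_le_mul_of_nonneg_right hdD (div_nonneg (hτ0 d) hd0.le)
    _ = A * (((Y - X : ℕ) : ℝ) + D) * ∑ d ∈ Finset.Icc 1 D, τ d / d := by ring
    _ ≤ A * (((Y - X : ℕ) : ℝ) + D) * (1 + Real.log D) ^ k := by
        gcongr



end ShortInterval

/-! ### The difference kernel -/

/-- `0 ≤ η − log(1 + η) ≤ η²` for `η ≥ 0`. [folklore] -/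
theorem sub_log_one_add_le_sq {η : ℝ} (hη : 0 ≤ η) :
    0 ≤ η - Real.log (1 + η) ∧ η - Real.log (1 + η) ≤ η ^ 2 := by
  have h1 : Real.log (1 + η) ≤ η := by
    have := Real.log_le_sub_one_of_pos (by linarith : (0 : ℝ) < 1 + η); linarith
  have h2 : 1 - (1 + η)⁻¹ ≤ Real.log (1 + η) := Real.one_sub_inv_le_log_of_pos (by linarith)
  have h3 : η - η ^ 2 ≤ 1 - (1 + η)⁻¹ := by
    rw [show 1 - (1 + η)⁻¹ = η / (1 + η) by field_simp; ring, le_div_iff₀ (by linarith)]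
    nlinarith [sq_nonneg η, mul_nonneg hη (sq_nonneg η)]
  exact ⟨by linarith, by linarith⟩

/-- **The difference kernel**: for `0 ≤ η`, `‖w‖ ≤ W` with `η W ≤ 1`,
`‖(1 + η)^{w} − 1 − w η‖ ≤ (W² + W) η²` (principal power of the positive real `1 + η`). [folklore] -/
theorem norm_one_add_cpow_sub_sub_le {η W : ℝ} (hη : 0 ≤ η) (hW : 0 ≤ W) (hηW : η * W ≤ 1) {w : ℂ}
    (hw : ‖w‖ ≤ W) :
    ‖((1 + η : ℝ) : ℂ) ^ w - 1 - w * η‖ ≤ (W ^ 2 + W) * η ^ 2 := by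
  set u : ℝ := Real.log (1 + η) with hu
  obtain ⟨hu1, hu2⟩ := sub_log_one_add_le_sq hη
  have hu0 : 0 ≤ u := Real.log_nonneg (by linarith)
  have huη : u ≤ η := by linarith
  have hpos : (0 : ℝ) < 1 + η := by linarith
  -- `(1+η)^w = exp(u w)`
  have hcpow : ((1 + η : ℝ) : ℂ) ^ w = exp ((u : ℂ) * w) := by
    rw [cpow_def_of_ne_zero (ofReal_ne_zero.2 hpos.ne'), ← ofReal_log hpos.le]
  have hx : ‖(u : ℂ) * w‖ ≤ η * W := by
    rw [norm_mul, norm_real, Real.norm_of_nonneg hu0]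
    exact mul_le_mul huη hw (norm_nonneg _) hη
  have hx1 : ‖(u : ℂ) * w‖ ≤ 1 := hx.trans hηW
  have h1 : ‖exp ((u : ℂ) * w) - 1 - (u : ℂ) * w‖ ≤ ‖(u : ℂ) * w‖ ^ 2 :=
    Complex.norm_exp_sub_one_sub_id_le hx1
  have h2 : ‖w * ((u : ℂ) - η)‖ ≤ W * η ^ 2 := by
    rw [norm_mul, show (u : ℂ) - η = ((u - η : ℝ) : ℂ) by push_cast; ring, norm_real,
      Real.norm_eq_abs, abs_sub_comm, abs_of_nonneg hu1]
    exact mul_le_mul hw hu2 hu1 hW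
  have e : ((1 + η : ℝ) : ℂ) ^ w - 1 - w * η =
      (exp ((u : ℂ) * w) - 1 - (u : ℂ) * w) + w * ((u : ℂ) - η) := by rw [hcpow]; ring
  rw [e]
  calc ‖(exp ((u : ℂ) * w) - 1 - (u : ℂ) * w) + w * ((u : ℂ) - η)‖
      ≤ ‖(u : ℂ) * w‖ ^ 2 + W * η ^ 2 := (norm_add_le _ _).trans (add_le_add h1 h2)
    _ ≤ (η * W) ^ 2 + W * η ^ 2 := by gcongr
    _ = (W ^ 2 + W) * η ^ 2 := by ring

/-- The difference kernel is entire in `w` (as a function of `s`, `w = 1 + s`). [folklore] -/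
theorem continuous_one_add_cpow_sub_sub {η : ℝ} (hη : 0 ≤ η) :
    Continuous fun s : ℂ ↦ ((1 + η : ℝ) : ℂ) ^ (1 + s) - 1 - (1 + s) * η := by
  have hpos : ((1 + η : ℝ) : ℂ) ≠ 0 := ofReal_ne_zero.2 (by linarith)
  have h1 : Continuous fun s : ℂ ↦ ((1 + η : ℝ) : ℂ) ^ (1 + s) :=
    Continuous.const_cpow (by fun_prop) (Or.inl hpos)
  fun_prop

/-- `((1 + η) x)^{w} = (1 + η)^{w} x^{w}` for `x > 0`, `η ≥ 0`. [folklore] -/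
theorem one_add_mul_cpow {η x : ℝ} (hη : 0 ≤ η) (hx : 0 < x) (w : ℂ) :
    (((1 + η) * x : ℝ) : ℂ) ^ w = ((1 + η : ℝ) : ℂ) ^ w * (x : ℂ) ^ w := by
  rw [ofReal_mul]
  exact mul_cpow_ofReal_nonneg (by linarith) hx.le w

/-- `‖w‖^{−a} ≤ L^{R} ‖w‖^{R − a}` when `1/L ≤ ‖w‖`, `L > 0`, `0 ≤ R`. [folklore] -/
theorem rpow_neg_le_mul_rpow {w : ℂ} {L R a : ℝ} (hL : 0 < L) (hR : 0 ≤ R) (hw : 1 / L ≤ ‖w‖) :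
    ‖w‖ ^ (-a) ≤ L ^ R * ‖w‖ ^ (R - a) := by
  have hw0 : 0 < ‖w‖ := lt_of_lt_of_le (by positivity) hw
  have h1 : ‖w‖ ^ (-a) = ‖w‖ ^ (-R) * ‖w‖ ^ (R - a) := by
    rw [← Real.rpow_add hw0]; congr 1; ring
  rw [h1]
  refine mul_le_mul_of_nonneg_right ?_ (Real.rpow_nonneg hw0.le _)
  calc ‖w‖ ^ (-R) ≤ (1 / L) ^ (-R) := Real.rpow_le_rpow_of_nonpos (by positivity) hw (by linarith)
    _ = L ^ R := by rw [one_div, Real.inv_rpow hL.le, Real.rpow_neg hL.le, inv_inv]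


/-! ### The holomorphic factors near `s = 1` -/

/-- **The smooth factors on a disc around `s = 1`.** With `ρ₁ = min(1/4, zfrWidth 1/2)` and
`‖z‖ ≤ R`: `𝒢₀(s) = F(s,z) exp(z logZeta₁ s)/s` is holomorphic on `ball 1 ρ₁` and bounded there by
`M₀`, and so is `Q_z(s) = F(s,z) exp(z logZeta₁ s)/(s(s+1))`. [cite: MontgomeryVaughan2007, §7.4 p. 178] -/
theorem exists_bound_G₀ (R : ℝ) (hR : 0 ≤ R) :
    ∃ M₀ : ℝ, 0 ≤ M₀ ∧ ∀ z : ℂ, ‖z‖ ≤ R →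
      DifferentiableOn ℂ (fun s ↦ selbergF s z * exp (z * logZeta₁ s) * s⁻¹)
        (ball (1 : ℂ) (min (1 / 4) (zfrWidth 1 / 2))) ∧
      (∀ s ∈ ball (1 : ℂ) (min (1 / 4) (zfrWidth 1 / 2)),
        ‖selbergF s z * exp (z * logZeta₁ s) * s⁻¹‖ ≤ M₀) ∧
      (∀ s ∈ ball (1 : ℂ) (min (1 / 4) (zfrWidth 1 / 2)),
        ‖selbergF s z * (exp (z * logZeta₁ s) * kernel s)‖ ≤ M₀) := by
  obtain ⟨M, hM, hlog⟩ := exists_norm_logZeta₁_le_near_one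
  obtain ⟨B, hB, hF⟩ := exists_bound_selbergF (by norm_num : (1 : ℝ) / 2 < 3 / 4) R
  obtain ⟨A, hA, hG⟩ := exists_bound_lipschitz_G R hR
  set ρ₁ : ℝ := min (1 / 4) (zfrWidth 1 / 2) with hρ₁
  have hρ₁pos : 0 < ρ₁ := lt_min (by norm_num) (by linarith [zfrWidth_pos 1])
  refine ⟨B * Real.exp (R * M) * 2 + B * A, by positivity, fun z hz ↦ ?_⟩
  -- geometry of the ball
  have hgeo : ∀ w ∈ ball (1 : ℂ) ρ₁, |w.im| ≤ 1 ∧ 1 - zfrWidth 1 / 2 ≤ w.re ∧ w.re ≤ 2 ∧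
      3 / 4 ≤ w.re ∧ w ≠ 0 ∧ w + 1 ≠ 0 ∧ ‖w⁻¹‖ ≤ 2 := by
    intro w hw
    rw [mem_ball, dist_eq_norm] at hw
    have h1 : ‖w - 1‖ < 1 / 4 := lt_of_lt_of_le hw (min_le_left _ _)
    have h2 : ‖w - 1‖ < zfrWidth 1 / 2 := lt_of_lt_of_le hw (min_le_right _ _)
    have him : |w.im| ≤ 1 := by
      have := abs_im_le_norm (w - 1); simp at this; linarith
    have hre : |w.re - 1| ≤ 1 / 4 := by
      have := abs_re_le_norm (w - 1); simp only [sub_re, one_re] at this; linarith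
    have hre2 : |w.re - 1| < zfrWidth 1 / 2 := by
      have := abs_re_le_norm (w - 1); simp only [sub_re, one_re] at this; linarith
    rw [abs_le] at hre
    rw [abs_lt] at hre2
    have hw0 : w ≠ 0 := fun h ↦ by rw [h] at hre; simp at hre; linarith [hre.1]
    have hw1 : w + 1 ≠ 0 := fun h ↦ by
      have := congrArg Complex.re h; simp at this; linarith [hre.1]
    have hnorm : 3 / 4 ≤ ‖w‖ := by
      have := abs_re_le_norm w
      rw [abs_le] at this
      linarith [this.2, hre.1]
    refine ⟨him, by linarith [hre2.1], by linarith [hre.2], by linarith [hre.1], hw0, hw1, ?_⟩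
    rw [norm_inv]
    calc ‖w‖⁻¹ ≤ (3 / 4 : ℝ)⁻¹ := by
          rw [inv_le_inv₀ (by linarith) (by norm_num)]; exact hnorm
      _ ≤ 2 := by norm_num
  refine ⟨?_, ?_, ?_⟩
  · intro w hw
    have hwΩ : w ∈ zfrRegion := ball_one_subset_zfrRegion hw
    obtain ⟨-, -, -, hre, hw0, -, -⟩ := hgeo w hw
    have hL : DifferentiableAt ℂ logZeta₁ w :=
      differentiableOn_logZeta₁.differentiableAt (isOpen_zfrRegion.mem_nhds hwΩ)
    have hFd : DifferentiableAt ℂ (fun s ↦ selbergF s z) w :=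
      (differentiableOn_selbergF z).differentiableAt
        ((isOpen_lt continuous_const continuous_re).mem_nhds (by simp; linarith))
    exact ((hFd.mul (hL.const_mul z).cexp).mul (differentiableAt_inv hw0)).differentiableWithinAt
  · intro w hw
    obtain ⟨him, hre1, hre2, hre, hw0, -, hinv⟩ := hgeo w hw
    have hLn : ‖logZeta₁ w‖ ≤ M := hlog w him hre1 hre2
    have hE : ‖exp (z * logZeta₁ w)‖ ≤ Real.exp (R * M) := by
      refine (norm_exp_mul_le _ _).trans ?_
      rw [Real.exp_le_exp]
      exact mul_le_mul hz hLn (norm_nonneg _) hR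
    rw [norm_mul, norm_mul]
    calc ‖selbergF w z‖ * ‖exp (z * logZeta₁ w)‖ * ‖w⁻¹‖ ≤ B * Real.exp (R * M) * 2 := by
          gcongr; exact hF w z hre hz
      _ ≤ B * Real.exp (R * M) * 2 + B * A := by nlinarith
  · intro w hw
    obtain ⟨-, -, -, hre, -, -, -⟩ := hgeo w hw
    rw [norm_mul]
    calc ‖selbergF w z‖ * ‖exp (z * logZeta₁ w) * kernel w‖ ≤ B * A := by
          gcongr
          · exact hF w z hre hz
          · exact (hG z hz).1 w hw
      _ ≤ B * Real.exp (R * M) * 2 + B * A := by nlinarith [Real.exp_pos (R * M)]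

/-- `𝒢₀(1) = F(1, z)`. [folklore] -/
theorem G₀_one (z : ℂ) : selbergF 1 z * exp (z * logZeta₁ 1) * (1 : ℂ)⁻¹ = selbergF 1 z := by
  rw [logZeta₁_one, mul_zero, Complex.exp_zero, inv_one, mul_one, mul_one]

/-! ### Keyhole bookkeeping -/

/-- Two integrands that agree at the points of the keyhole have the same keyhole integral.
[folklore] -/
theorem keyhole_congr {F G : ℂ → ℂ} {b a δ : ℝ} (h : ∀ s, onKeyhole b a δ s → F s = G s) :
    keyhole F b a δ = keyhole G b a δ := by
  unfold keyhole
  have h1 : ∫ σ in b..a, F ((σ : ℂ) + ((-δ : ℝ) : ℂ) * I) = ∫ σ in b..a, G ((σ : ℂ) + ((-δ : ℝ) : ℂ) * I) :=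
    intervalIntegral.integral_congr fun σ hσ ↦ h _ (Or.inl ⟨σ, hσ, rfl⟩)
  have h2 : ∫ σ in b..a, F ((σ : ℂ) + (δ : ℂ) * I) = ∫ σ in b..a, G ((σ : ℂ) + (δ : ℂ) * I) :=
    intervalIntegral.integral_congr fun σ hσ ↦ h _ (Or.inr (Or.inl ⟨σ, hσ, rfl⟩))
  have h3 : ∫ t in (-δ)..δ, F ((a : ℂ) + (t : ℂ) * I) = ∫ t in (-δ)..δ, G ((a : ℂ) + (t : ℂ) * I) :=
    intervalIntegral.integral_congr fun t ht ↦ h _ (Or.inr (Or.inr ⟨t, ht, rfl⟩))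
  rw [h1, h2, h3]

/-- The points of the keyhole `b = 1 − β/L`, `a = 1 + 1/L`, `δ = 1/L` are at distance `≥ 1/L` from
`1`. [folklore] -/
theorem onKeyhole_norm_sub_one_ge {L β : ℝ} (hL : 0 < L) {s : ℂ}
    (hs : onKeyhole (1 - β / L) (1 + 1 / L) (1 / L) s) : 1 / L ≤ ‖s - 1‖ := by
  rcases hs with ⟨σ, -, rfl⟩ | ⟨σ, -, rfl⟩ | ⟨t, -, rfl⟩
  · have him : ((σ : ℂ) + ((-(1 / L) : ℝ) : ℂ) * I - 1).im = -(1 / L) := by simp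
    calc 1 / L = |((σ : ℂ) + ((-(1 / L) : ℝ) : ℂ) * I - 1).im| := by
          rw [him, abs_neg, abs_of_pos (by positivity)]
      _ ≤ _ := abs_im_le_norm _
  · have him : ((σ : ℂ) + (((1 / L : ℝ)) : ℂ) * I - 1).im = 1 / L := by simp
    calc 1 / L = |((σ : ℂ) + (((1 / L : ℝ)) : ℂ) * I - 1).im| := by
          rw [him, abs_of_pos (by positivity)]
      _ ≤ _ := abs_im_le_norm _
  · have hre : (((1 + 1 / L : ℝ) : ℂ) + (t : ℂ) * I - 1).re = 1 / L := by simp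
    calc 1 / L = |(((1 + 1 / L : ℝ) : ℂ) + (t : ℂ) * I - 1).re| := by
          rw [hre, abs_of_pos (by positivity)]
      _ ≤ _ := abs_re_le_norm _

set_option maxHeartbeats 1600000 in
/-- **The keyhole integral of the difference `Ψ_{(1+η)x} − Ψ_x`** (MV's `𝒞₂`, p. 178, for the
averaged kernel). With `x = e^L`, `L ≥ 4`, `0 < η ≤ 1/L`, the keyhole `b = 1 − β/L`, `a = 1 + 1/L`,
`δ = 1/L` (`β ≥ 1`, `(β+1)/L ≤ ρ₁/4`) and `‖z‖ ≤ R`: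
`keyhole(Ψ_{(1+η)x}) − keyhole(Ψ_x) = η F(1,z) x² L^{z−1} hankelLoop β z + O_R(η x² L^{Re z − 2})`.
Here `((1+η)x)^{1+s} − x^{1+s} = x^{1+s}((1+s)η + O(η²))`; the linear part is the keyhole of
`(s−1)^{−z} 𝒢₀(s) x^{1+s}` (`𝒢₀ = F e^{z logZeta₁}/s`), expanded by
`Keyhole.norm_keyhole_sub_sum_le` to order `N = ⌈R⌉₊ + 1` (the terms `k ≥ 1` are
`O(x² L^{Re z − 2})` by Cauchy's estimates), and the quadratic part is `O(η² x² L^{Re z − 1})` by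
`Keyhole.norm_keyhole_le`. [cite: MontgomeryVaughan2007, §7.4 p. 178 (7.58)] -/
theorem exists_norm_keyhole_diff_le (R : ℝ) (hR : 0 < R) :
    ∃ C : ℝ, 0 ≤ C ∧ ∀ L : ℝ, 4 ≤ L → ∀ η : ℝ, 0 < η → η * L ≤ 1 →
      ∀ β : ℝ, 1 ≤ β → (β + 1) / L ≤ min (1 / 4) (zfrWidth 1 / 2) / 4 →
      ∀ z : ℂ, ‖z‖ ≤ R → ∀ Ψ₁ Ψ₂ : ℂ → ℂ,
      (∀ s, Ψ₁ s = ((Real.exp L : ℝ) : ℂ) ^ (1 + s) *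
        (selbergF s z * exp (z * (logZeta₁ s - log (s - 1)))) * kernel s) →
      (∀ s, Ψ₂ s = (((1 + η) * Real.exp L : ℝ) : ℂ) ^ (1 + s) *
        (selbergF s z * exp (z * (logZeta₁ s - log (s - 1)))) * kernel s) →
      ‖keyhole Ψ₂ (1 - β / L) (1 + 1 / L) (1 / L) - keyhole Ψ₁ (1 - β / L) (1 + 1 / L) (1 / L) -
          η * (selbergF 1 z * (((Real.exp L : ℝ) : ℂ) ^ 2 * (L : ℂ) ^ (z - 1) * hankelLoop β z))‖ ≤
        C * η * Real.exp L ^ 2 * L ^ (z.re - 2) := by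
  -- constants
  set N : ℕ := ⌈R⌉₊ + 1 with hNdef
  have hRN : R ≤ N := by
    rw [hNdef]; push_cast; linarith [Nat.le_ceil R]
  have hN1 : 1 ≤ N := by rw [hNdef]; omega
  set n : ℕ := ⌈2 * R⌉₊ with hndef
  set ρ₁ : ℝ := min (1 / 4) (zfrWidth 1 / 2) with hρ₁
  have hρ₁pos : 0 < ρ₁ := lt_min (by norm_num) (by linarith [zfrWidth_pos 1])
  have hρ₁le : ρ₁ ≤ 1 / 4 := min_le_left _ _
  have hρ₁ne : ρ₁ ≠ 0 := hρ₁pos.ne'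
  obtain ⟨KT, hKT, hTaylor⟩ := Literature.Analysis.Complex.Keyhole.norm_keyhole_sub_sum_le R N hRN
  obtain ⟨M₀, hM₀, hG₀⟩ := exists_bound_G₀ R hR.le
  obtain ⟨CH, hCH, hHankel⟩ := Literature.Analysis.Complex.Keyhole.hankelLoop_sub_le (R + N)
  have hΓc : ContinuousOn (fun w : ℂ ↦ (Complex.Gamma w)⁻¹) (closedBall 0 (R + N)) :=
    Complex.differentiable_one_div_Gamma.continuous.continuousOn
  obtain ⟨MΓ, hMΓ⟩ := (isCompact_closedBall (0 : ℂ) (R + N)).exists_bound_of_continuousOn hΓc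
  have hMΓ0 : 0 ≤ MΓ := (norm_nonneg _).trans (hMΓ 0 (mem_closedBall_self (by positivity)))
  set Hb : ℝ := 2 * π * MΓ + CH with hHb
  have hHb0 : 0 ≤ Hb := by positivity
  have h2ρ : 1 ≤ 2 / ρ₁ := by rw [le_div_iff₀ hρ₁pos]; linarith
  set CT : ℝ := M₀ * (2 / ρ₁) ^ N * Hb with hCT
  have hKn := Literature.Analysis.Complex.Keyhole.keyholeConst_pos n
  set C : ℝ := KT * (M₀ / ρ₁ ^ N) + (⌈R⌉₊ : ℝ) * CT +
    12 * Real.exp (π * R) * M₀ * Literature.Analysis.Complex.Keyhole.keyholeConst n with hC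
  refine ⟨C, by positivity, fun L hL4 η hη hηL β hβ hfit z hz Ψ₁ Ψ₂ hΨ₁ hΨ₂ ↦ ?_⟩
  -- parameters
  have hL1 : 1 ≤ L := by linarith
  have hL0 : 0 < L := by linarith
  set x : ℝ := Real.exp L with hxdef
  have hx0 : 0 < x := Real.exp_pos L
  have hx1 : 1 < x := by rw [hxdef]; exact Real.one_lt_exp_iff.2 hL0
  have hlogx : Real.log x = L := Real.log_exp L
  have hη0 : 0 ≤ η := hη.le
  have hη1 : η ≤ 1 / L := by rw [le_div_iff₀ hL0]; exact hηL
  have hη3 : η * 3 ≤ 1 := by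
    have : η ≤ 1 / 4 := hη1.trans (by rw [div_le_iff₀ hL0]; linarith)
    linarith
  obtain ⟨hdiffG₀, hbdG₀, hbdQ⟩ := hG₀ z hz
  -- the functions
  set 𝒢₀ : ℂ → ℂ := fun s ↦ selbergF s z * exp (z * logZeta₁ s) * s⁻¹ with h𝒢₀
  set Q : ℂ → ℂ := fun s ↦ selbergF s z * (exp (z * logZeta₁ s) * kernel s) with hQ
  set E : ℂ → ℂ := fun s ↦ ((1 + η : ℝ) : ℂ) ^ (1 + s) - 1 - (1 + s) * η with hE
  set Φm : ℂ → ℂ := fun s ↦ (s - 1) ^ (-z) * 𝒢₀ s * (x : ℂ) ^ (1 + s) with hΦm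
  set Φe : ℂ → ℂ := fun s ↦ (s - 1) ^ (-z) * (Q s * E s) * (x : ℂ) ^ (1 + s) with hΦe
  -- keyhole points
  have hkey : ∀ s, onKeyhole (1 - β / L) (1 + 1 / L) (1 / L) s →
      s - 1 ∈ slitPlane ∧ ‖s - 1‖ ≤ ρ₁ / 4 ∧ s ∈ ball (1 : ℂ) ρ₁ ∧ s ∈ zfrSlitRegion ∧ s ≠ 1 ∧
        1 / L ≤ ‖s - 1‖ ∧ ‖1 + s‖ ≤ 3 ∧ s ≠ 0 ∧ s + 1 ≠ 0 := by
    intro s hs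
    obtain ⟨hslit, hnorm⟩ := Literature.Analysis.Complex.Keyhole.onKeyhole_mem hL0 hβ hs
    have hnorm' : ‖s - 1‖ ≤ ρ₁ / 4 := hnorm.trans hfit
    have hball : s ∈ ball (1 : ℂ) ρ₁ := by
      rw [mem_ball, dist_eq_norm]; linarith
    have hreg : s ∈ zfrRegion := ball_one_subset_zfrRegion hball
    have hs1 : s ≠ 1 := by
      intro h; rw [h, sub_self] at hslit; exact slitPlane_ne_zero hslit rfl
    have hre : |s.re - 1| ≤ 1 / 16 := by
      have := abs_re_le_norm (s - 1); simp only [sub_re, one_re] at this; linarith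
    rw [abs_le] at hre
    have hs0 : s ≠ 0 := fun h ↦ by rw [h] at hre; simp at hre; linarith [hre.1]
    have hsm1 : s + 1 ≠ 0 := fun h ↦ by
      have := congrArg Complex.re h; simp at this; linarith [hre.1]
    refine ⟨hslit, hnorm', hball, ⟨hreg, hslit⟩, hs1, onKeyhole_norm_sub_one_ge hL0 hs, ?_, hs0, hsm1⟩
    calc ‖1 + s‖ = ‖(s - 1) + 2‖ := by ring_nf
      _ ≤ ‖s - 1‖ + ‖(2 : ℂ)‖ := norm_add_le _ _
      _ ≤ 3 := by rw [Complex.norm_two]; linarith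
  -- pointwise identity on the keyhole
  have hpt : ∀ s, onKeyhole (1 - β / L) (1 + 1 / L) (1 / L) s →
      Ψ₂ s = Ψ₁ s + (η * Φm s + Φe s) := by
    intro s hs
    obtain ⟨-, -, -, -, hs1, -, -, hs0, hsm1⟩ := hkey s hs
    rw [hΨ₂, hΨ₁, one_add_mul_cpow hη0 hx0, mul_assoc (((1 + η : ℝ) : ℂ) ^ (1 + s)),
      mul_assoc (((1 + η : ℝ) : ℂ) ^ (1 + s)), integrand_eq_cpow_mul x z hs1]
    simp only [hΦm, hΦe, h𝒢₀, hQ, hE]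
    have hker : kernel s = 1 / (s * (s + 1)) := rfl
    rw [hker]
    field_simp
    ring
  -- continuity at keyhole points
  have hcΨ₁ : ∀ s, onKeyhole (1 - β / L) (1 + 1 / L) (1 / L) s → ContinuousAt Ψ₁ s := by
    intro s hs
    obtain ⟨-, -, -, hsl, -⟩ := hkey s hs
    have hfun : Ψ₁ = fun s ↦ ((Real.exp L : ℝ) : ℂ) ^ (1 + s) *
        (selbergF s z * exp (z * (logZeta₁ s - log (s - 1)))) * kernel s := funext hΨ₁
    rw [hfun]
    exact ((differentiableOn_integrand hx0 z).differentiableAt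
      (isOpen_zfrSlitRegion.mem_nhds hsl)).continuousAt
  have hc𝒢₀ : ∀ s, onKeyhole (1 - β / L) (1 + 1 / L) (1 / L) s → ContinuousAt 𝒢₀ s := fun s hs ↦
    (hdiffG₀.differentiableAt (isOpen_ball.mem_nhds (hkey s hs).2.2.1)).continuousAt
  have hcQ : ∀ s, onKeyhole (1 - β / L) (1 + 1 / L) (1 / L) s → ContinuousAt Q s := by
    intro s hs
    obtain ⟨-, -, hball, hsl, -, -, -, hs0, hsm1⟩ := hkey s hs
    have hreg : s ∈ zfrRegion := hsl.1
    have hL : ContinuousAt logZeta₁ s :=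
      (differentiableOn_logZeta₁.differentiableAt (isOpen_zfrRegion.mem_nhds hreg)).continuousAt
    have hFd : ContinuousAt (fun s ↦ selbergF s z) s :=
      ((differentiableOn_selbergF z).differentiableAt
        ((isOpen_lt continuous_const continuous_re).mem_nhds
          (half_lt_re_of_mem_zfrRegion hreg))).continuousAt
    have hk : ContinuousAt kernel s := by
      change ContinuousAt (fun s : ℂ ↦ 1 / (s * (s + 1))) s
      exact continuousAt_const.div (continuousAt_id.mul (continuousAt_id.add continuousAt_const))
        (mul_ne_zero hs0 hsm1)
    simp only [hQ]
    exact hFd.mul ((continuousAt_const.mul hL).cexp.mul hk)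
  have hcE : ∀ s, ContinuousAt E s := fun s ↦ (continuous_one_add_cpow_sub_sub hη0).continuousAt
  have hcmono : ∀ (w : ℂ) s, onKeyhole (1 - β / L) (1 + 1 / L) (1 / L) s →
      ContinuousAt (fun s ↦ (s - 1) ^ (-w) * (x : ℂ) ^ (1 + s)) s := fun w s hs ↦
    Literature.Analysis.Complex.Keyhole.continuousAt_monomial hx0 w (hkey s hs).1
  have hcΦm : ∀ s, onKeyhole (1 - β / L) (1 + 1 / L) (1 / L) s → ContinuousAt Φm s := by
    intro s hs
    have h1 : ContinuousAt (fun s : ℂ ↦ (s - 1) ^ (-z)) s :=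
      (continuousAt_cpow_const (hkey s hs).1).comp (f := fun s : ℂ ↦ s - 1) (by fun_prop)
    have h2 : ContinuousAt (fun s : ℂ ↦ (x : ℂ) ^ (1 + s)) s :=
      (continuousAt_const_cpow (ofReal_ne_zero.2 hx0.ne')).comp (f := fun s : ℂ ↦ 1 + s) (by fun_prop)
    simp only [hΦm]
    exact (h1.mul (hc𝒢₀ s hs)).mul h2
  have hcΦe : ∀ s, onKeyhole (1 - β / L) (1 + 1 / L) (1 / L) s → ContinuousAt Φe s := by
    intro s hs
    have h1 : ContinuousAt (fun s : ℂ ↦ (s - 1) ^ (-z)) s :=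
      (continuousAt_cpow_const (hkey s hs).1).comp (f := fun s : ℂ ↦ s - 1) (by fun_prop)
    have h2 : ContinuousAt (fun s : ℂ ↦ (x : ℂ) ^ (1 + s)) s :=
      (continuousAt_const_cpow (ofReal_ne_zero.2 hx0.ne')).comp (f := fun s : ℂ ↦ 1 + s) (by fun_prop)
    simp only [hΦe]
    exact (h1.mul ((hcQ s hs).mul (hcE s))).mul h2
  -- the keyhole of the difference
  have hsplit : keyhole Ψ₂ (1 - β / L) (1 + 1 / L) (1 / L) - keyhole Ψ₁ (1 - β / L) (1 + 1 / L) (1 / L) =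
      η * keyhole Φm (1 - β / L) (1 + 1 / L) (1 / L) + keyhole Φe (1 - β / L) (1 + 1 / L) (1 / L) := by
    have e1 : keyhole Ψ₂ (1 - β / L) (1 + 1 / L) (1 / L) =
        keyhole (fun s ↦ Ψ₁ s + ((η : ℂ) * Φm s + Φe s)) (1 - β / L) (1 + 1 / L) (1 / L) :=
      keyhole_congr hpt
    have e2 : keyhole (fun s ↦ Ψ₁ s + ((η : ℂ) * Φm s + Φe s)) (1 - β / L) (1 + 1 / L) (1 / L) =
        keyhole Ψ₁ (1 - β / L) (1 + 1 / L) (1 / L) +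
          keyhole (fun s ↦ (η : ℂ) * Φm s + Φe s) (1 - β / L) (1 + 1 / L) (1 / L) :=
      Literature.Analysis.Complex.Keyhole.keyhole_add (F := Ψ₁) (G := fun s ↦ (η : ℂ) * Φm s + Φe s)
        hcΨ₁ (fun s hs ↦ (continuousAt_const.mul (hcΦm s hs)).add (hcΦe s hs))
    have e3 : keyhole (fun s ↦ (η : ℂ) * Φm s + Φe s) (1 - β / L) (1 + 1 / L) (1 / L) =
        keyhole (fun s ↦ (η : ℂ) * Φm s) (1 - β / L) (1 + 1 / L) (1 / L) +
          keyhole Φe (1 - β / L) (1 + 1 / L) (1 / L) :=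
      Literature.Analysis.Complex.Keyhole.keyhole_add (F := fun s ↦ (η : ℂ) * Φm s) (G := Φe)
        (fun s hs ↦ continuousAt_const.mul (hcΦm s hs)) hcΦe
    have e4 : keyhole (fun s ↦ (η : ℂ) * Φm s) (1 - β / L) (1 + 1 / L) (1 / L) =
        η * keyhole Φm (1 - β / L) (1 + 1 / L) (1 / L) :=
      Literature.Analysis.Complex.Keyhole.keyhole_const_mul Φm η _ _ _
    rw [e1, e2, e3, e4]
    ring
  -- (1) the Taylor expansion of the linear part
  have hT := hTaylor 𝒢₀ ρ₁ M₀ hρ₁pos hdiffG₀ hbdG₀ x β hx1 hβ (by rwa [hlogx]) z hz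
  rw [hlogx] at hT
  -- (2) the main term `k = 0` and the terms `k ≥ 1`
  have hterm0 : ((0 ! : ℕ) : ℂ)⁻¹ * iteratedDeriv 0 𝒢₀ 1 *
      ((x : ℂ) ^ 2 * (L : ℂ) ^ ((z - (0 : ℕ)) - 1) * hankelLoop β (z - (0 : ℕ))) =
      selbergF 1 z * ((x : ℂ) ^ 2 * (L : ℂ) ^ (z - 1) * hankelLoop β z) := by
    rw [iteratedDeriv_zero, Nat.factorial_zero, Nat.cast_one, inv_one, one_mul, Nat.cast_zero, sub_zero]
    simp only [h𝒢₀]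
    rw [G₀_one]
  have hterms : ∀ k ∈ Finset.range ⌈R⌉₊,
      ‖(((k + 1) ! : ℕ) : ℂ)⁻¹ * iteratedDeriv (k + 1) 𝒢₀ 1 *
        ((x : ℂ) ^ 2 * (L : ℂ) ^ ((z - ((k + 1 : ℕ) : ℂ)) - 1) * hankelLoop β (z - ((k + 1 : ℕ) : ℂ)))‖ ≤
        CT * x ^ 2 * L ^ (z.re - 2) := by
    intro k hk
    have hk' : k + 1 ≤ N := by
      rw [hNdef]; have := Finset.mem_range.1 hk; omega
    -- Cauchy estimate
    have hCauchy := Literature.Analysis.Complex.norm_iteratedDeriv_le_of_forall_mem_ball hρ₁pos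
      hdiffG₀ hbdG₀ (k + 1)
    have hfact : (0 : ℝ) < ((k + 1) ! : ℕ) := by exact_mod_cast Nat.factorial_pos _
    have hcoef : ‖(((k + 1) ! : ℕ) : ℂ)⁻¹ * iteratedDeriv (k + 1) 𝒢₀ 1‖ ≤ M₀ * (2 / ρ₁) ^ N := by
      rw [norm_mul, norm_inv, Complex.norm_natCast]
      calc (((k + 1) ! : ℕ) : ℝ)⁻¹ * ‖iteratedDeriv (k + 1) 𝒢₀ 1‖
          ≤ (((k + 1) ! : ℕ) : ℝ)⁻¹ * (((k + 1) ! : ℕ) * M₀ / (ρ₁ / 2) ^ (k + 1)) :=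
            mul_le_mul_of_nonneg_left hCauchy (by positivity)
        _ = M₀ / (ρ₁ / 2) ^ (k + 1) := by
            field_simp
        _ = M₀ * (2 / ρ₁) ^ (k + 1) := by
            rw [div_eq_mul_inv, ← inv_pow, inv_div]
        _ ≤ M₀ * (2 / ρ₁) ^ N := mul_le_mul_of_nonneg_left (pow_le_pow_right₀ h2ρ hk') hM₀
    -- the Hankel loop is bounded
    have hζ : ‖z - ((k + 1 : ℕ) : ℂ)‖ ≤ R + N := by
      calc ‖z - ((k + 1 : ℕ) : ℂ)‖ ≤ ‖z‖ + ‖((k + 1 : ℕ) : ℂ)‖ := norm_sub_le _ _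
        _ ≤ R + N := by
            rw [Complex.norm_natCast]; exact add_le_add hz (by exact_mod_cast hk')
    have hloop : ‖hankelLoop β (z - ((k + 1 : ℕ) : ℂ))‖ ≤ Hb := by
      have h1 := hHankel β hβ _ hζ
      have h2 : ‖2 * π * I / Complex.Gamma (z - ((k + 1 : ℕ) : ℂ))‖ ≤ 2 * π * MΓ := by
        rw [norm_div, norm_mul, norm_mul, Complex.norm_I, mul_one, Complex.norm_two, Complex.norm_real,
          Real.norm_of_nonneg Real.pi_pos.le, div_eq_mul_inv, ← norm_inv]
        exact mul_le_mul_of_nonneg_left (hMΓ _ (by simpa using hζ)) (by positivity)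
      calc ‖hankelLoop β (z - ((k + 1 : ℕ) : ℂ))‖
          = ‖(hankelLoop β (z - ((k + 1 : ℕ) : ℂ)) - 2 * π * I / Complex.Gamma (z - ((k + 1 : ℕ) : ℂ))) +
              2 * π * I / Complex.Gamma (z - ((k + 1 : ℕ) : ℂ))‖ := by ring_nf
        _ ≤ CH * Real.exp (-β / 2) + 2 * π * MΓ := (norm_add_le _ _).trans (add_le_add h1 h2)
        _ ≤ CH * 1 + 2 * π * MΓ := by
            gcongr; rw [Real.exp_le_one_iff]; linarith
        _ = Hb := by rw [hHb]; ring
    -- the power of `L`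
    have hLpow : ‖(x : ℂ) ^ 2 * (L : ℂ) ^ ((z - ((k + 1 : ℕ) : ℂ)) - 1)‖ ≤ x ^ 2 * L ^ (z.re - 2) := by
      rw [norm_mul, norm_pow, Complex.norm_real, Real.norm_of_nonneg hx0.le,
        norm_cpow_eq_rpow_re_of_pos hL0]
      refine mul_le_mul_of_nonneg_left ?_ (by positivity)
      refine Real.rpow_le_rpow_of_exponent_le hL1 ?_
      simp only [sub_re, natCast_re, one_re]
      have : (1 : ℝ) ≤ (k + 1 : ℕ) := by exact_mod_cast Nat.le_add_left 1 k
      linarith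
    have hXLH : ‖(x : ℂ) ^ 2 * (L : ℂ) ^ ((z - ((k + 1 : ℕ) : ℂ)) - 1) * hankelLoop β (z - ((k + 1 : ℕ) : ℂ))‖ ≤
        (x ^ 2 * L ^ (z.re - 2)) * Hb := by
      rw [norm_mul]
      have : 0 ≤ x ^ 2 * L ^ (z.re - 2) := by
        have := Real.rpow_nonneg hL0.le (z.re - 2); positivity
      exact mul_le_mul hLpow hloop (norm_nonneg _) this
    calc ‖(((k + 1) ! : ℕ) : ℂ)⁻¹ * iteratedDeriv (k + 1) 𝒢₀ 1 *
          ((x : ℂ) ^ 2 * (L : ℂ) ^ ((z - ((k + 1 : ℕ) : ℂ)) - 1) * hankelLoop β (z - ((k + 1 : ℕ) : ℂ)))‖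
        ≤ ‖(((k + 1) ! : ℕ) : ℂ)⁻¹ * iteratedDeriv (k + 1) 𝒢₀ 1‖ *
            ‖(x : ℂ) ^ 2 * (L : ℂ) ^ ((z - ((k + 1 : ℕ) : ℂ)) - 1) * hankelLoop β (z - ((k + 1 : ℕ) : ℂ))‖ :=
          norm_mul_le _ _
      _ ≤ (M₀ * (2 / ρ₁) ^ N) * ((x ^ 2 * L ^ (z.re - 2)) * Hb) :=
          mul_le_mul hcoef hXLH (norm_nonneg _) (by positivity)
      _ = CT * x ^ 2 * L ^ (z.re - 2) := by rw [hCT]; ring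
  have hsum_split : ∑ k ∈ Finset.range N, ((k ! : ℕ) : ℂ)⁻¹ * iteratedDeriv k 𝒢₀ 1 *
      ((x : ℂ) ^ 2 * (L : ℂ) ^ ((z - (k : ℂ)) - 1) * hankelLoop β (z - (k : ℂ))) =
      selbergF 1 z * ((x : ℂ) ^ 2 * (L : ℂ) ^ (z - 1) * hankelLoop β z) +
      ∑ k ∈ Finset.range ⌈R⌉₊, (((k + 1) ! : ℕ) : ℂ)⁻¹ * iteratedDeriv (k + 1) 𝒢₀ 1 *
        ((x : ℂ) ^ 2 * (L : ℂ) ^ ((z - ((k + 1 : ℕ) : ℂ)) - 1) * hankelLoop β (z - ((k + 1 : ℕ) : ℂ))) := by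
    rw [hNdef, Finset.sum_range_succ', ← hterm0]
    ring
  have hsum_le : ‖∑ k ∈ Finset.range ⌈R⌉₊, (((k + 1) ! : ℕ) : ℂ)⁻¹ * iteratedDeriv (k + 1) 𝒢₀ 1 *
        ((x : ℂ) ^ 2 * (L : ℂ) ^ ((z - ((k + 1 : ℕ) : ℂ)) - 1) * hankelLoop β (z - ((k + 1 : ℕ) : ℂ)))‖ ≤
      (⌈R⌉₊ : ℝ) * CT * x ^ 2 * L ^ (z.re - 2) := by
    refine (norm_sum_le _ _).trans ?_
    calc ∑ k ∈ Finset.range ⌈R⌉₊, ‖(((k + 1) ! : ℕ) : ℂ)⁻¹ * iteratedDeriv (k + 1) 𝒢₀ 1 *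
          ((x : ℂ) ^ 2 * (L : ℂ) ^ ((z - ((k + 1 : ℕ) : ℂ)) - 1) * hankelLoop β (z - ((k + 1 : ℕ) : ℂ)))‖
        ≤ ∑ k ∈ Finset.range ⌈R⌉₊, CT * x ^ 2 * L ^ (z.re - 2) := Finset.sum_le_sum hterms
      _ = (⌈R⌉₊ : ℝ) * CT * x ^ 2 * L ^ (z.re - 2) := by
          rw [Finset.sum_const, Finset.card_range, nsmul_eq_mul]; ring
  -- (3) the quadratic part
  have hRez : |z.re| ≤ R := (abs_re_le_norm z).trans hz
  have hp0 : 0 ≤ R - z.re := by linarith [le_abs_self z.re]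
  have hpn : R - z.re ≤ n := by
    rw [hndef]
    calc R - z.re ≤ 2 * R := by linarith [neg_abs_le z.re]
      _ ≤ ⌈2 * R⌉₊ := Nat.le_ceil _
  set Ae : ℝ := Real.exp (π * R) * L ^ R * M₀ * (12 * η ^ 2) with hAe
  have hAe0 : 0 ≤ Ae := by positivity
  have hbdΦe : ∀ s, onKeyhole (1 - β / Real.log x) (1 + 1 / Real.log x) (1 / Real.log x) s →
      ‖Φe s‖ ≤ Ae * ‖s - 1‖ ^ (R - z.re) * x ^ (1 + s.re) := by
    intro s hs
    rw [hlogx] at hs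
    obtain ⟨-, -, hball, -, hs1, hlow, h1s, -, -⟩ := hkey s hs
    have hw : s - 1 ≠ 0 := sub_ne_zero.2 hs1
    have h1 : ‖(s - 1) ^ (-z)‖ ≤ Real.exp (π * R) * L ^ R * ‖s - 1‖ ^ (R - z.re) := by
      calc ‖(s - 1) ^ (-z)‖ ≤ ‖s - 1‖ ^ (-z.re) * Real.exp (π * |z.im|) :=
            Literature.Analysis.Complex.Keyhole.norm_cpow_neg_le hw z
        _ ≤ (L ^ R * ‖s - 1‖ ^ (R - z.re)) * Real.exp (π * R) := by
            gcongr
            · exact rpow_neg_le_mul_rpow hL0 hR.le hlow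
            · exact (abs_im_le_norm z).trans hz
        _ = Real.exp (π * R) * L ^ R * ‖s - 1‖ ^ (R - z.re) := by ring
    have h2 : ‖Q s‖ ≤ M₀ := hbdQ s hball
    have h3 : ‖E s‖ ≤ (3 ^ 2 + 3) * η ^ 2 := by
      simp only [hE]
      exact norm_one_add_cpow_sub_sub_le hη0 (by norm_num) hη3 h1s
    have h4 : ‖(x : ℂ) ^ (1 + s)‖ = x ^ (1 + s.re) := by
      rw [norm_cpow_eq_rpow_re_of_pos hx0, add_re, one_re]
    simp only [hΦe]
    rw [norm_mul, norm_mul, norm_mul, h4]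
    have hpos : 0 ≤ ‖s - 1‖ ^ (R - z.re) := Real.rpow_nonneg (norm_nonneg _) _
    calc ‖(s - 1) ^ (-z)‖ * (‖Q s‖ * ‖E s‖) * x ^ (1 + s.re)
        ≤ (Real.exp (π * R) * L ^ R * ‖s - 1‖ ^ (R - z.re)) * (M₀ * ((3 ^ 2 + 3) * η ^ 2)) *
            x ^ (1 + s.re) := by
          have : 0 ≤ x ^ (1 + s.re) := Real.rpow_nonneg hx0.le _
          gcongr
      _ = Ae * ‖s - 1‖ ^ (R - z.re) * x ^ (1 + s.re) := by rw [hAe]; ring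
  have hΦe_le := Literature.Analysis.Complex.Keyhole.norm_keyhole_le hx1 hβ hAe0 hp0 hpn hbdΦe
  rw [hlogx] at hΦe_le
  have hΦe_le' : ‖keyhole Φe (1 - β / L) (1 + 1 / L) (1 / L)‖ ≤
      12 * Real.exp (π * R) * M₀ * Literature.Analysis.Complex.Keyhole.keyholeConst n *
        η * x ^ 2 * L ^ (z.re - 2) := by
    refine hΦe_le.trans ?_
    rw [hAe]
    have hLsplit : L ^ R * η ^ 2 * L ^ (-(R - z.re) - 1) ≤ η * L ^ (z.re - 2) := by
      have e1 : L ^ R * L ^ (-(R - z.re) - 1) = L * L ^ (z.re - 2) := by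
        rw [← Real.rpow_add hL0, show R + (-(R - z.re) - 1) = 1 + (z.re - 2) by ring,
          Real.rpow_add hL0, Real.rpow_one]
      calc L ^ R * η ^ 2 * L ^ (-(R - z.re) - 1) = η * (η * L) * L ^ (z.re - 2) := by
            rw [show L ^ R * η ^ 2 * L ^ (-(R - z.re) - 1) = η ^ 2 * (L ^ R * L ^ (-(R - z.re) - 1)) by ring,
              e1]; ring
        _ ≤ η * 1 * L ^ (z.re - 2) := by
            have := Real.rpow_nonneg hL0.le (z.re - 2)
            gcongr
        _ = η * L ^ (z.re - 2) := by ring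
    calc Real.exp (π * R) * L ^ R * M₀ * (12 * η ^ 2) * Literature.Analysis.Complex.Keyhole.keyholeConst n *
          x ^ 2 * L ^ (-(R - z.re) - 1)
        = 12 * Real.exp (π * R) * M₀ * Literature.Analysis.Complex.Keyhole.keyholeConst n * x ^ 2 *
            (L ^ R * η ^ 2 * L ^ (-(R - z.re) - 1)) := by ring
      _ ≤ 12 * Real.exp (π * R) * M₀ * Literature.Analysis.Complex.Keyhole.keyholeConst n * x ^ 2 *
            (η * L ^ (z.re - 2)) := mul_le_mul_of_nonneg_left hLsplit (by positivity)
      _ = _ := by ring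
  -- (4) the Taylor error
  have hT' : ‖keyhole Φm (1 - β / L) (1 + 1 / L) (1 / L) -
      (selbergF 1 z * ((x : ℂ) ^ 2 * (L : ℂ) ^ (z - 1) * hankelLoop β z) +
        ∑ k ∈ Finset.range ⌈R⌉₊, (((k + 1) ! : ℕ) : ℂ)⁻¹ * iteratedDeriv (k + 1) 𝒢₀ 1 *
          ((x : ℂ) ^ 2 * (L : ℂ) ^ ((z - ((k + 1 : ℕ) : ℂ)) - 1) * hankelLoop β (z - ((k + 1 : ℕ) : ℂ))))‖ ≤
      KT * (M₀ / ρ₁ ^ N) * x ^ 2 * L ^ (z.re - 2) := by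
    rw [← hsum_split]
    refine hT.trans ?_
    have : L ^ (z.re - N - 1) ≤ L ^ (z.re - 2) := by
      refine Real.rpow_le_rpow_of_exponent_le hL1 ?_
      have : (1 : ℝ) ≤ N := by exact_mod_cast hN1
      linarith
    have h0 : 0 ≤ KT * (M₀ / ρ₁ ^ N) * x ^ 2 := by positivity
    exact mul_le_mul_of_nonneg_left this h0
  -- (5) assembly
  have hxL : 0 ≤ x ^ 2 * L ^ (z.re - 2) := by
    have := Real.rpow_nonneg hL0.le (z.re - 2); positivity
  rw [hsplit]
  set Main : ℂ := selbergF 1 z * ((x : ℂ) ^ 2 * (L : ℂ) ^ (z - 1) * hankelLoop β z) with hMain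
  set Srest : ℂ := ∑ k ∈ Finset.range ⌈R⌉₊, (((k + 1) ! : ℕ) : ℂ)⁻¹ * iteratedDeriv (k + 1) 𝒢₀ 1 *
      ((x : ℂ) ^ 2 * (L : ℂ) ^ ((z - ((k + 1 : ℕ) : ℂ)) - 1) * hankelLoop β (z - ((k + 1 : ℕ) : ℂ)))
    with hSrest
  have e : (η : ℂ) * keyhole Φm (1 - β / L) (1 + 1 / L) (1 / L) + keyhole Φe (1 - β / L) (1 + 1 / L) (1 / L) -
      η * Main =
      η * (keyhole Φm (1 - β / L) (1 + 1 / L) (1 / L) - (Main + Srest)) + η * Srest +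
        keyhole Φe (1 - β / L) (1 + 1 / L) (1 / L) := by ring
  rw [e]
  have hηn : ‖(η : ℂ)‖ = η := by rw [Complex.norm_real, Real.norm_of_nonneg hη0]
  calc ‖η * (keyhole Φm (1 - β / L) (1 + 1 / L) (1 / L) - (Main + Srest)) + η * Srest +
        keyhole Φe (1 - β / L) (1 + 1 / L) (1 / L)‖
      ≤ ‖(η : ℂ)‖ * ‖keyhole Φm (1 - β / L) (1 + 1 / L) (1 / L) - (Main + Srest)‖ + ‖(η : ℂ)‖ * ‖Srest‖ +
          ‖keyhole Φe (1 - β / L) (1 + 1 / L) (1 / L)‖ := by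
        refine (norm_add_le _ _).trans (add_le_add ((norm_add_le _ _).trans (add_le_add ?_ ?_)) le_rfl)
        · rw [norm_mul]
        · rw [norm_mul]
    _ ≤ η * (KT * (M₀ / ρ₁ ^ N) * x ^ 2 * L ^ (z.re - 2)) + η * ((⌈R⌉₊ : ℝ) * CT * x ^ 2 * L ^ (z.re - 2)) +
          12 * Real.exp (π * R) * M₀ * Literature.Analysis.Complex.Keyhole.keyholeConst n *
            η * x ^ 2 * L ^ (z.re - 2) := by
        rw [hηn]
        exact add_le_add (add_le_add (mul_le_mul_of_nonneg_left hT' hη0)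
          (mul_le_mul_of_nonneg_left hsum_le hη0)) hΦe_le'
    _ = C * η * x ^ 2 * L ^ (z.re - 2) := by rw [hC]; ring




/-- `y^{1 + a} ≤ e² y²` for `1 ≤ y ≤ 2 e^L`, `a = 1 + 1/L`, `L ≥ 1`. [folklore] -/
theorem rpow_one_add_le_of_le {L y : ℝ} (hL : 1 ≤ L) (hy1 : 1 ≤ y) (hy : y ≤ 2 * Real.exp L) :
    y ^ (1 + (1 + 1 / L)) ≤ Real.exp 2 * y ^ 2 := by
  have hy0 : 0 < y := by linarith
  have hL0 : 0 < L := by linarith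
  have hlogy : Real.log y ≤ 2 * L := by
    have h1 : Real.log y ≤ Real.log (2 * Real.exp L) := Real.log_le_log hy0 hy
    rw [Real.log_mul (by norm_num) (Real.exp_ne_zero _), Real.log_exp] at h1
    have h2 : Real.log 2 ≤ 1 := by
      have := Real.log_two_lt_d9; norm_num at this; linarith
    linarith
  have h1 : y ^ (1 + (1 + 1 / L)) = y ^ 2 * y ^ (1 / L) := by
    rw [show 1 + (1 + 1 / L) = 2 + 1 / L by ring, Real.rpow_add hy0, Real.rpow_two]
  have h2 : y ^ (1 / L) ≤ Real.exp 2 := by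
    rw [Real.rpow_def_of_pos hy0, Real.exp_le_exp]
    calc Real.log y * (1 / L) = Real.log y / L := by ring
      _ ≤ 2 * L / L := div_le_div_of_nonneg_right hlogy hL0.le
      _ = 2 := by field_simp
  rw [h1]
  calc y ^ 2 * y ^ (1 / L) ≤ y ^ 2 * Real.exp 2 := mul_le_mul_of_nonneg_left h2 (by positivity)
    _ = Real.exp 2 * y ^ 2 := by ring

/-- `y^{1 + b} ≤ y² e^{−β}` for `e^L ≤ y`, `b = 1 − β/L`, `0 ≤ β`, `L > 0`. [folklore] -/
theorem rpow_one_add_le_of_exp_le {L y β : ℝ} (hL : 0 < L) (hβ : 0 ≤ β) (hy : Real.exp L ≤ y) :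
    y ^ (1 + (1 - β / L)) ≤ y ^ 2 * Real.exp (-β) := by
  have hy0 : 0 < y := lt_of_lt_of_le (Real.exp_pos L) hy
  have hlogy : L ≤ Real.log y := by
    have := Real.log_le_log (Real.exp_pos L) hy
    rwa [Real.log_exp] at this
  have h1 : y ^ (1 + (1 - β / L)) = y ^ 2 * y ^ (-(β / L)) := by
    rw [show 1 + (1 - β / L) = 2 + -(β / L) by ring, Real.rpow_add hy0, Real.rpow_two]
  rw [h1]
  refine mul_le_mul_of_nonneg_left ?_ (by positivity)
  rw [Real.rpow_def_of_pos hy0, Real.exp_le_exp]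
  have h2 : β ≤ Real.log y * (β / L) := by
    calc β = L * (β / L) := by field_simp
      _ ≤ Real.log y * (β / L) := mul_le_mul_of_nonneg_right hlogy (by positivity)
  linarith

set_option maxHeartbeats 1600000 in
/-- **The far pieces of the Selberg–Delange contour** (MV p. 178: the tails `|t| ≥ T` of the line
`σ = a`, the left side `σ = b` and the horizontal sides `t = ±T`), for the integrand
`Ψ(s) = y^{1+s} F(s,z) ζ(s)^z/(s(s+1))` with the contour attached to `L` (`a = 1 + 1/L`, `δ = 1/L`,
`T = e^{√L}`, `b = 1 − β/L`, `β = 2c̄L/log(T+3)`) but an arbitrary base `e^L ≤ y ≤ 2e^L`: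
`‖i∫_ℝ Ψ(a+it)dt − keyhole(Ψ)‖ ≤ C y² L^R e^{−c̄√L}`. [cite: MontgomeryVaughan2007, §7.4 p. 178] -/
theorem exists_norm_line_sub_keyhole_le (R : ℝ) (hR : 0 < R) :
    ∃ C : ℝ, 0 ≤ C ∧ ∀ L : ℝ, 4 ≤ L → 1 / zfrConst ^ 2 ≤ L →
      ∀ y : ℝ, Real.exp L ≤ y → y ≤ 2 * Real.exp L → ∀ z : ℂ, ‖z‖ ≤ R →
      ∀ β : ℝ, β = 2 * zfrConst * L / Real.log (Real.exp (Real.sqrt L) + 3) →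
      ∀ Ψ : ℂ → ℂ, (∀ s, Ψ s = (y : ℂ) ^ (1 + s) *
        (selbergF s z * exp (z * (logZeta₁ s - log (s - 1)))) * kernel s) →
      ‖I * (∫ t : ℝ, Ψ (((1 + 1 / L : ℝ) : ℂ) + t * I)) -
          keyhole Ψ (1 - β / L) (1 + 1 / L) (1 / L)‖ ≤
        C * y ^ 2 * L ^ R * Real.exp (-(zfrConst * Real.sqrt L)) := by
  obtain ⟨A', hA', htails⟩ := exists_norm_integral_tails_le R
  obtain ⟨Ah, hAh, hhoriz⟩ := exists_norm_integral_horizontal_le R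
  obtain ⟨Af, hAf, hleftfar⟩ := exists_norm_integral_left_far_le R hR.le
  obtain ⟨An, hAn, hleftnear⟩ := exists_norm_integral_left_near_le R hR.le
  have hc := zfrConst_pos
  have hcle := zfrConst_le
  set c₁ : ℝ := 2 * zfrConst with hc₁
  have hc₁pos : 0 < c₁ := by positivity
  refine ⟨2 * A' * Real.exp 2 + 2 * (An + Af) * 2 ^ R + 2 * Ah * 2 ^ R * Real.exp 2, by positivity,
    fun L hL4 hLc y hyL hy2L z hz β hβdef Ψ hΨ ↦ ?_⟩
  have hL1 : 1 ≤ L := by linarith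
  have hL0 : 0 < L := by linarith
  obtain ⟨hT3, hℓ1, hℓ2, hsqrt2, hsqrtL⟩ := params hL4
  have hy0 : 0 < y := lt_of_lt_of_le (Real.exp_pos L) hyL
  have hy1 : 1 ≤ y := le_trans (Real.one_le_exp (by linarith)) hyL
  set a : ℝ := 1 + 1 / L with ha
  set δ : ℝ := 1 / L with hδ
  set T : ℝ := Real.exp (Real.sqrt L) with hT
  set ℓ : ℝ := Real.log (T + 3) with hℓ
  set b : ℝ := 1 - β / L with hb
  have hδ0 : 0 < δ := by positivity
  have hδ1 : δ ≤ 1 := by rw [hδ, div_le_one hL0]; exact hL1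
  have ha1 : 1 < a := by rw [ha]; linarith
  have ha2 : a ≤ 2 := by rw [ha]; linarith
  have hT1 : 1 ≤ T := by linarith
  have hδT : δ ≤ T := by linarith
  have hℓ0 : 0 < ℓ := by linarith
  have hℓ4 : Real.log 4 ≤ ℓ := Real.log_le_log (by norm_num) (by linarith)
  have hβL : β / L = c₁ / ℓ := by rw [hβdef, hc₁]; field_simp
  have h1b : 1 - b = c₁ / ℓ := by rw [hb, hβL]; ring
  have hβ0 : 0 ≤ β := by rw [hβdef]; positivity
  have hc₁ℓ : c₁ / ℓ ≤ c₁ / 2 := div_le_div_of_nonneg_left hc₁pos.le (by norm_num) (by linarith)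
  have hc₁small : c₁ ≤ 1 / 50 := by rw [hc₁]; linarith
  have hb34 : 3 / 4 ≤ b := by
    have : b = 1 - c₁ / ℓ := by linarith
    rw [this]; linarith
  have hba : b ≤ a := by
    have : 0 ≤ c₁ / ℓ := by positivity
    have : b = 1 - c₁ / ℓ := by linarith
    rw [this, ha]; linarith
  have hb2 : b ≤ 2 := by linarith
  have hbw : 1 - zfrWidth 1 / 2 ≤ b := by
    have hw : zfrWidth 1 = 4 * zfrConst / Real.log 4 := by
      simp [zfrWidth, abs_one]; norm_num
    have : b = 1 - c₁ / ℓ := by linarith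
    rw [hw, this, hc₁]
    have hlog4 : 0 < Real.log 4 := Real.log_pos (by norm_num)
    have : 2 * zfrConst / ℓ ≤ 2 * zfrConst / Real.log 4 :=
      div_le_div_of_nonneg_left (by positivity) hlog4 hℓ4
    have e : 4 * zfrConst / Real.log 4 / 2 = 2 * zfrConst / Real.log 4 := by ring
    rw [e]; linarith
  have hreg : 1 - 4 * zfrConst / Real.log (T + 3) < b := by
    have : b = 1 - c₁ / ℓ := by linarith
    rw [this, hc₁, ← hℓ]
    have : 0 < zfrConst / ℓ := by positivity
    have e1 : 4 * zfrConst / ℓ = 4 * (zfrConst / ℓ) := by ring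
    have e2 : 2 * zfrConst / ℓ = 2 * (zfrConst / ℓ) := by ring
    rw [e1, e2]; linarith
  -- `β ≥ c̄ √L`
  have hβge : zfrConst * Real.sqrt L ≤ β := by
    rw [hβdef]
    have hsq : Real.sqrt L * Real.sqrt L = L := Real.mul_self_sqrt hL0.le
    rw [le_div_iff₀ hℓ0]
    calc zfrConst * Real.sqrt L * ℓ ≤ zfrConst * Real.sqrt L * (2 * Real.sqrt L) :=
          mul_le_mul_of_nonneg_left hℓ2 (by positivity)
      _ = 2 * zfrConst * L := by
          rw [show zfrConst * Real.sqrt L * (2 * Real.sqrt L) =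
            2 * zfrConst * (Real.sqrt L * Real.sqrt L) by ring, hsq]
  ------------------------------------------------------------------
  -- the integrand and the deformation
  ------------------------------------------------------------------
  have hΨfun : Ψ = fun s ↦ (y : ℂ) ^ (1 + s) *
      (selbergF s z * exp (z * (logZeta₁ s - log (s - 1)))) * kernel s := funext hΨ
  have hdiffΨ : DifferentiableOn ℂ Ψ zfrSlitRegion := by
    rw [hΨfun]; exact differentiableOn_integrand hy0 z
  have hcontΨ : ContinuousOn Ψ zfrSlitRegion := hdiffΨ.continuousOn
  have hregion : ∀ s : ℂ, |s.im| ≤ T → b ≤ s.re → s ∈ zfrRegion := fun s hs1 hs2 ↦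
    mem_zfrRegion_of_le hs1 (lt_of_lt_of_le hreg hs2)
  have hslit : ∀ s : ℂ, |s.im| ≤ T → b ≤ s.re → s.im ≠ 0 → s ∈ zfrSlitRegion := fun s hs1 hs2 hs3 ↦
    mem_zfrSlitRegion_of_im_ne_zero (hregion s hs1 hs2) hs3
  have hint : Integrable fun t : ℝ ↦ Ψ ((a : ℂ) + t * I) := by
    rw [hΨfun]; exact integrable_integrand_line hy0 z ha1
  have hdiff_top : DifferentiableOn ℂ Ψ (Icc b a ×ℂ Icc δ T) := by
    refine hdiffΨ.mono fun s hs ↦ hslit s ?_ hs.1.1 ?_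
    · exact abs_le.2 ⟨by linarith [hs.2.1], hs.2.2⟩
    · intro h; have := hs.2.1; rw [h] at this; linarith
  have hdiff_bot : DifferentiableOn ℂ Ψ (Icc b a ×ℂ Icc (-T) (-δ)) := by
    refine hdiffΨ.mono fun s hs ↦ hslit s ?_ hs.1.1 ?_
    · exact abs_le.2 ⟨hs.2.1, by linarith [hs.2.2]⟩
    · intro h; have := hs.2.2; rw [h] at this; linarith
  have hkey := integral_line_eq_keyhole (Ψ := Ψ) hδT hba hdiff_top hdiff_bot hint
  ------------------------------------------------------------------
  -- the three bounds
  ------------------------------------------------------------------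
  set E : ℝ := Real.exp (-(zfrConst * Real.sqrt L)) with hE
  have hE0 : 0 < E := Real.exp_pos _
  have hya : y ^ (1 + a) ≤ Real.exp 2 * y ^ 2 := rpow_one_add_le_of_le hL1 hy1 hy2L
  have hyb : y ^ (1 + b) ≤ y ^ 2 * E := by
    have h := rpow_one_add_le_of_exp_le (β := β) hL0 hβ0 hyL
    refine h.trans (mul_le_mul_of_nonneg_left ?_ (by positivity))
    rw [hE, Real.exp_le_exp]; linarith
  have hLR0 : 0 ≤ L ^ R := Real.rpow_nonneg hL0.le _
  have hLR1 : 1 ≤ L ^ R := Real.one_le_rpow hL1 hR.le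
  have hℓR : ℓ ^ R ≤ (2 * L) ^ R := by
    refine Real.rpow_le_rpow hℓ0.le ?_ hR.le
    calc ℓ ≤ 2 * Real.sqrt L := hℓ2
      _ ≤ 2 * L := by linarith
  have h2δR : (2 / δ) ^ R = (2 * L) ^ R := by rw [hδ]; congr 1; field_simp
  have h2LR : (2 * L) ^ R = 2 ^ R * L ^ R := Real.mul_rpow (by norm_num) hL0.le
  -- (1) tails: `T^{-1/2} = e^{-√L/2} ≤ E`
  have hTrpow : T ^ (-(1 / 2 : ℝ)) ≤ E := by
    rw [hT, ← Real.exp_mul, hE, Real.exp_le_exp]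
    nlinarith [Real.sqrt_nonneg L]
  obtain ⟨htail1, htail2⟩ := htails y hy0 a T ha1.le ha2 hT1 z hz Ψ hΨ
  have hTails : ‖I * ((∫ t in Iic (-T), Ψ ((a : ℂ) + t * I)) + ∫ t in Ioi T, Ψ ((a : ℂ) + t * I))‖ ≤
      2 * A' * Real.exp 2 * y ^ 2 * L ^ R * E := by
    rw [norm_mul, Complex.norm_I, one_mul]
    calc ‖(∫ t in Iic (-T), Ψ ((a : ℂ) + t * I)) + ∫ t in Ioi T, Ψ ((a : ℂ) + t * I)‖
        ≤ A' * y ^ (1 + a) * T ^ (-(1 / 2 : ℝ)) + A' * y ^ (1 + a) * T ^ (-(1 / 2 : ℝ)) :=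
          (norm_add_le _ _).trans (add_le_add htail2 htail1)
      _ = 2 * A' * y ^ (1 + a) * T ^ (-(1 / 2 : ℝ)) := by ring
      _ ≤ 2 * A' * (Real.exp 2 * y ^ 2) * E := by
          have : 0 ≤ T ^ (-(1 / 2 : ℝ)) := Real.rpow_nonneg (by linarith) _
          gcongr
      _ = 2 * A' * Real.exp 2 * y ^ 2 * 1 * E := by ring
      _ ≤ 2 * A' * Real.exp 2 * y ^ 2 * L ^ R * E := by gcongr
  -- (2) the left verticals on `σ = b`
  obtain ⟨hfar1, hfar2⟩ := hleftfar y hy0 b T hb34 hb2 hT1 hreg z hz Ψ hΨ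
  obtain ⟨hnear1, hnear2⟩ := hleftnear y hy0 b δ hb34 hbw hb2 hδ0 hδ1 z hz Ψ hΨ
  have hvint : ∀ c d : ℝ, δ ≤ c → c ≤ d → d ≤ T →
      IntervalIntegrable (fun t : ℝ ↦ Ψ ((b : ℂ) + t * I)) volume c d := by
    intro c d hc hcd hd
    refine Literature.Analysis.Complex.intervalIntegrable_vertical_of_continuousOn hcontΨ b hcd
      fun t ht ↦ hslit _ ?_ ?_ ?_
    · simp only [add_im, ofReal_im, mul_im, ofReal_re, I_im, mul_one, I_re, mul_zero, add_zero, zero_add]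
      exact abs_le.2 ⟨by linarith [ht.1], by linarith [ht.2]⟩
    · simp
    · simp only [add_im, ofReal_im, mul_im, ofReal_re, I_im, mul_one, I_re, mul_zero, add_zero, zero_add]
      intro h; linarith [ht.1]
  have hvint' : ∀ c d : ℝ, -T ≤ c → c ≤ d → d ≤ -δ →
      IntervalIntegrable (fun t : ℝ ↦ Ψ ((b : ℂ) + t * I)) volume c d := by
    intro c d hc hcd hd
    refine Literature.Analysis.Complex.intervalIntegrable_vertical_of_continuousOn hcontΨ b hcd
      fun t ht ↦ hslit _ ?_ ?_ ?_
    · simp only [add_im, ofReal_im, mul_im, ofReal_re, I_im, mul_one, I_re, mul_zero, add_zero, zero_add]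
      exact abs_le.2 ⟨by linarith [ht.1], by linarith [ht.2]⟩
    · simp
    · simp only [add_im, ofReal_im, mul_im, ofReal_re, I_im, mul_one, I_re, mul_zero, add_zero, zero_add]
      intro h; linarith [ht.2]
  have hLeft : ‖I * ((∫ t in (-T)..(-δ), Ψ ((b : ℂ) + t * I)) + ∫ t in δ..T, Ψ ((b : ℂ) + t * I))‖ ≤
      2 * (An + Af) * 2 ^ R * y ^ 2 * L ^ R * E := by
    rw [norm_mul, Complex.norm_I, one_mul]
    have hsplit1 : ∫ t in δ..T, Ψ ((b : ℂ) + t * I) =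
        (∫ t in δ..(1 : ℝ), Ψ ((b : ℂ) + t * I)) + ∫ t in (1 : ℝ)..T, Ψ ((b : ℂ) + t * I) :=
      (intervalIntegral.integral_add_adjacent_intervals (hvint δ 1 le_rfl hδ1 hT1)
        (hvint 1 T hδ1 hT1 le_rfl)).symm
    have hsplit2 : ∫ t in (-T)..(-δ), Ψ ((b : ℂ) + t * I) =
        (∫ t in (-T)..(-1 : ℝ), Ψ ((b : ℂ) + t * I)) + ∫ t in (-1 : ℝ)..(-δ), Ψ ((b : ℂ) + t * I) :=
      (intervalIntegral.integral_add_adjacent_intervals (hvint' (-T) (-1) le_rfl (by linarith) (by linarith))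
        (hvint' (-1) (-δ) (by linarith) (by linarith) le_rfl)).symm
    have hsum : ‖(∫ t in (-T)..(-δ), Ψ ((b : ℂ) + t * I)) + ∫ t in δ..T, Ψ ((b : ℂ) + t * I)‖ ≤
        2 * (An * (2 / δ) ^ R * y ^ (1 + b) + Af * ℓ ^ R * y ^ (1 + b)) := by
      rw [hsplit1, hsplit2]
      calc ‖(∫ t in (-T)..(-1 : ℝ), Ψ ((b : ℂ) + t * I)) + (∫ t in (-1 : ℝ)..(-δ), Ψ ((b : ℂ) + t * I)) +
            ((∫ t in δ..(1 : ℝ), Ψ ((b : ℂ) + t * I)) + ∫ t in (1 : ℝ)..T, Ψ ((b : ℂ) + t * I))‖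
          ≤ (‖∫ t in (-T)..(-1 : ℝ), Ψ ((b : ℂ) + t * I)‖ + ‖∫ t in (-1 : ℝ)..(-δ), Ψ ((b : ℂ) + t * I)‖) +
            (‖∫ t in δ..(1 : ℝ), Ψ ((b : ℂ) + t * I)‖ + ‖∫ t in (1 : ℝ)..T, Ψ ((b : ℂ) + t * I)‖) :=
            (norm_add_le _ _).trans (add_le_add (norm_add_le _ _) (norm_add_le _ _))
        _ ≤ (Af * ℓ ^ R * y ^ (1 + b) + An * (2 / δ) ^ R * y ^ (1 + b)) +
            (An * (2 / δ) ^ R * y ^ (1 + b) + Af * ℓ ^ R * y ^ (1 + b)) :=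
            add_le_add (add_le_add hfar2 hnear2) (add_le_add hnear1 hfar1)
        _ = _ := by ring
    refine hsum.trans ?_
    rw [h2δR]
    have hyb' : 0 ≤ y ^ (1 + b) := Real.rpow_nonneg hy0.le _
    have hℓy : Af * (ℓ ^ R * y ^ (1 + b)) ≤ Af * ((2 * L) ^ R * y ^ (1 + b)) :=
      mul_le_mul_of_nonneg_left (mul_le_mul_of_nonneg_right hℓR hyb') hAf
    have hkey2 : (2 * L) ^ R * y ^ (1 + b) ≤ 2 ^ R * y ^ 2 * L ^ R * E := by
      rw [h2LR]
      calc 2 ^ R * L ^ R * y ^ (1 + b) ≤ 2 ^ R * L ^ R * (y ^ 2 * E) := by gcongr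
        _ = 2 ^ R * y ^ 2 * L ^ R * E := by ring
    calc 2 * (An * (2 * L) ^ R * y ^ (1 + b) + Af * ℓ ^ R * y ^ (1 + b))
        = 2 * (An * ((2 * L) ^ R * y ^ (1 + b)) + Af * (ℓ ^ R * y ^ (1 + b))) := by ring
      _ ≤ 2 * (An * ((2 * L) ^ R * y ^ (1 + b)) + Af * ((2 * L) ^ R * y ^ (1 + b))) := by
          linarith [hℓy]
      _ = 2 * (An + Af) * ((2 * L) ^ R * y ^ (1 + b)) := by ring
      _ ≤ 2 * (An + Af) * (2 ^ R * y ^ 2 * L ^ R * E) :=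
          mul_le_mul_of_nonneg_left hkey2 (by positivity)
      _ = _ := by ring
  -- (3) the horizontal sides `t = ±T`: `1/T² = e^{-2√L} ≤ E`
  have hhor1 := hhoriz y hy1 a b T hb34 hba ha2 hT1 hreg z hz Ψ hΨ T (Or.inl rfl)
  have hhor2 := hhoriz y hy1 a b T hb34 hba ha2 hT1 hreg z hz Ψ hΨ (-T) (Or.inr rfl)
  have hT2 : (T ^ 2)⁻¹ ≤ E := by
    rw [hT, ← Real.exp_nat_mul, ← Real.exp_neg, hE, Real.exp_le_exp]
    push_cast
    nlinarith [Real.sqrt_nonneg L]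
  have hHoriz : ‖(∫ x in b..a, Ψ ((x : ℂ) + T * I)) - ∫ x in b..a, Ψ ((x : ℂ) + ((-T : ℝ) : ℂ) * I)‖ ≤
      2 * Ah * 2 ^ R * Real.exp 2 * y ^ 2 * L ^ R * E := by
    have hℓR' : 0 ≤ ℓ ^ R := Real.rpow_nonneg hℓ0.le _
    have hkey3 : Ah * ℓ ^ R * y ^ (1 + a) / T ^ 2 ≤ Ah * 2 ^ R * Real.exp 2 * y ^ 2 * L ^ R * E := by
      rw [div_eq_mul_inv]
      calc Ah * ℓ ^ R * y ^ (1 + a) * (T ^ 2)⁻¹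
          ≤ Ah * (2 * L) ^ R * (Real.exp 2 * y ^ 2) * E := by
            have : 0 ≤ (T ^ 2)⁻¹ := by positivity
            gcongr
        _ = Ah * 2 ^ R * Real.exp 2 * y ^ 2 * L ^ R * E := by rw [h2LR]; ring
    calc ‖(∫ x in b..a, Ψ ((x : ℂ) + T * I)) - ∫ x in b..a, Ψ ((x : ℂ) + ((-T : ℝ) : ℂ) * I)‖
        ≤ ‖∫ x in b..a, Ψ ((x : ℂ) + T * I)‖ + ‖∫ x in b..a, Ψ ((x : ℂ) + ((-T : ℝ) : ℂ) * I)‖ :=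
          norm_sub_le _ _
      _ ≤ Ah * ℓ ^ R * y ^ (1 + a) / T ^ 2 + Ah * ℓ ^ R * y ^ (1 + a) / T ^ 2 := add_le_add hhor1 hhor2
      _ ≤ 2 * (Ah * 2 ^ R * Real.exp 2 * y ^ 2 * L ^ R * E) := by linarith
      _ = _ := by ring
  ------------------------------------------------------------------
  -- conclusion
  ------------------------------------------------------------------
  have hdiff : I * (∫ t : ℝ, Ψ ((a : ℂ) + t * I)) - keyhole Ψ b a δ =
      I * ((∫ t in Iic (-T), Ψ ((a : ℂ) + t * I)) + ∫ t in Ioi T, Ψ ((a : ℂ) + t * I)) +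
      I * ((∫ t in (-T)..(-δ), Ψ ((b : ℂ) + t * I)) + ∫ t in δ..T, Ψ ((b : ℂ) + t * I)) +
      ((∫ x in b..a, Ψ ((x : ℂ) + T * I)) - ∫ x in b..a, Ψ ((x : ℂ) + ((-T : ℝ) : ℂ) * I)) := by
    rw [hkey, Literature.Analysis.Complex.Keyhole.keyhole]
    ring
  rw [hdiff]
  calc ‖I * ((∫ t in Iic (-T), Ψ ((a : ℂ) + t * I)) + ∫ t in Ioi T, Ψ ((a : ℂ) + t * I)) +
        I * ((∫ t in (-T)..(-δ), Ψ ((b : ℂ) + t * I)) + ∫ t in δ..T, Ψ ((b : ℂ) + t * I)) +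
        ((∫ x in b..a, Ψ ((x : ℂ) + T * I)) - ∫ x in b..a, Ψ ((x : ℂ) + ((-T : ℝ) : ℂ) * I))‖
      ≤ 2 * A' * Real.exp 2 * y ^ 2 * L ^ R * E + 2 * (An + Af) * 2 ^ R * y ^ 2 * L ^ R * E +
          2 * Ah * 2 ^ R * Real.exp 2 * y ^ 2 * L ^ R * E :=
        (norm_add_le _ _).trans (add_le_add ((norm_add_le _ _).trans (add_le_add hTails hLeft)) hHoriz)
    _ = (2 * A' * Real.exp 2 + 2 * (An + Af) * 2 ^ R + 2 * Ah * 2 ^ R * Real.exp 2) * y ^ 2 * L ^ R * E := by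
        ring


/-! ### The arithmetic side of the de-smoothing -/

/-- **De-smoothing identity**: `I_z(y₂) − I_z(x) = (y₂ − x) A_z(x) + Σ_{x < n ≤ y₂} z^{ω(n)} (y₂ − n)`
for `0 ≤ x ≤ y₂`, where `I_z(y) = Σ_{n ≤ y} z^{ω(n)}(y − n)` and `A_z(x) = Σ_{n ≤ x} z^{ω(n)}`. [folklore] -/
theorem rieszMean_sub_rieszMean {x y₂ : ℝ} (hxy : x ≤ y₂) (z : ℂ) :
    (∑ n ∈ Finset.Ioc 0 ⌊y₂⌋₊, omegaCoeff z n * ((y₂ : ℂ) - n)) -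
      ∑ n ∈ Finset.Ioc 0 ⌊x⌋₊, omegaCoeff z n * ((x : ℂ) - n) =
      ((y₂ - x : ℝ) : ℂ) * ∑ n ∈ Finset.Ioc 0 ⌊x⌋₊, omegaCoeff z n +
        ∑ n ∈ Finset.Ioc ⌊x⌋₊ ⌊y₂⌋₊, omegaCoeff z n * ((y₂ : ℂ) - n) := by
  have hfl : ⌊x⌋₊ ≤ ⌊y₂⌋₊ := Nat.floor_le_floor hxy
  rw [← Finset.sum_Ioc_consecutive _ (Nat.zero_le _) hfl, Finset.mul_sum]
  have : ∑ n ∈ Finset.Ioc 0 ⌊x⌋₊, omegaCoeff z n * ((y₂ : ℂ) - n) -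
      ∑ n ∈ Finset.Ioc 0 ⌊x⌋₊, omegaCoeff z n * ((x : ℂ) - n) =
      ∑ n ∈ Finset.Ioc 0 ⌊x⌋₊, ((y₂ - x : ℝ) : ℂ) * omegaCoeff z n := by
    rw [← Finset.sum_sub_distrib]
    refine Finset.sum_congr rfl fun n _ ↦ ?_
    push_cast; ring
  linear_combination this

/-- **The short sum**: `‖Σ_{x < n ≤ y₂} z^{ω(n)} (y₂ − n)‖ ≤ (y₂ − x) Σ_{x < n ≤ y₂} A^{ω(n)}` for
`‖z‖ ≤ A`, `0 ≤ x ≤ y₂`. [folklore] -/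
theorem norm_shortSum_le {x y₂ A : ℝ} (hx : 0 ≤ x) (hxy : x ≤ y₂) {z : ℂ} (hz : ‖z‖ ≤ A) :
    ‖∑ n ∈ Finset.Ioc ⌊x⌋₊ ⌊y₂⌋₊, omegaCoeff z n * ((y₂ : ℂ) - n)‖ ≤
      (y₂ - x) * ∑ n ∈ Finset.Ioc ⌊x⌋₊ ⌊y₂⌋₊, A ^ (ω n) := by
  have hA : 0 ≤ A := (norm_nonneg z).trans hz
  rw [Finset.mul_sum]
  refine (norm_sum_le _ _).trans (Finset.sum_le_sum fun n hn ↦ ?_)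
  have hn' := Finset.mem_Ioc.1 hn
  have hxn : x < n := lt_of_lt_of_le (Nat.lt_floor_add_one x) (by exact_mod_cast hn'.1)
  have hny : (n : ℝ) ≤ y₂ := le_trans (by exact_mod_cast hn'.2) (Nat.floor_le (hx.trans hxy))
  rw [norm_mul, norm_omegaCoeff, show ((y₂ : ℂ) - n) = ((y₂ - n : ℝ) : ℂ) by push_cast; ring,
    Complex.norm_real, Real.norm_of_nonneg (by linarith), mul_comm]
  exact mul_le_mul (by linarith) (pow_le_pow_left₀ (norm_nonneg _) hz _) (by positivity) (by linarith)

/-- **The short-interval input of the de-smoothing**: for `A ≥ 1`, `A² ≤ k`, `L ≥ 4`, `x = e^L`,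
`0 ≤ η ≤ 1`, `y₂ = (1 + η) x`: `Σ_{x < n ≤ y₂} A^{ω(n)} ≤ A 2^k (η x + 3 e^{−L/2} x) L^k`. [folklore] -/
theorem sum_short_le {A : ℝ} (hA : 1 ≤ A) {k : ℕ} (hk : A ^ 2 ≤ k) {L η : ℝ} (hL : 4 ≤ L)
    (hη0 : 0 ≤ η) (hη1 : η ≤ 1) :
    ∑ n ∈ Finset.Ioc ⌊Real.exp L⌋₊ ⌊(1 + η) * Real.exp L⌋₊, A ^ (ω n) ≤
      A * 2 ^ k * (η * Real.exp L + 3 * (Real.exp (-(L / 2)) * Real.exp L)) * L ^ k := by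
  set x : ℝ := Real.exp L with hxdef
  set y₂ : ℝ := (1 + η) * x with hy₂
  have hx0 : 0 < x := Real.exp_pos L
  have hx1 : 1 ≤ x := Real.one_le_exp (by linarith)
  have hxy : x ≤ y₂ := by rw [hy₂]; nlinarith
  have hy2x : y₂ ≤ 2 * x := by rw [hy₂]; nlinarith
  set X : ℕ := ⌊x⌋₊ with hX
  set Y : ℕ := ⌊y₂⌋₊ with hY
  have hXY : X ≤ Y := Nat.floor_le_floor hxy
  have h := sum_Ioc_pow_cardDistinctFactors_le hA hk hXY
  -- `√x = e^{L/2}`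
  have hsqrtx : Real.sqrt x = Real.exp (L / 2) := by rw [hxdef, Real.exp_half]
  have hexpx : Real.exp (-(L / 2)) * x = Real.exp (L / 2) := by
    rw [hxdef, ← Real.exp_add]; congr 1; ring
  -- `Y − X ≤ η x + 1`
  have hYX : ((Y - X : ℕ) : ℝ) ≤ η * x + 1 := by
    rw [Nat.cast_sub hXY]
    have h1 : (Y : ℝ) ≤ y₂ := Nat.floor_le (by linarith)
    have h2 : x < (X : ℝ) + 1 := Nat.lt_floor_add_one x
    rw [hy₂] at h1
    linarith
  -- `sqrt Y ≤ 2 e^{L/2}` and `1 ≤ sqrt Y`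
  have hY1 : 1 ≤ Y := by
    rw [hY, Nat.one_le_floor_iff]; linarith
  have hsY1 : 1 ≤ Nat.sqrt Y := by rw [Nat.le_sqrt]; simpa using hY1
  have hsY : (Nat.sqrt Y : ℝ) ≤ 2 * Real.exp (L / 2) := by
    have h1 : ((Nat.sqrt Y : ℕ) : ℝ) ^ 2 ≤ Y := by exact_mod_cast Nat.sqrt_le' Y
    have h2 : (Y : ℝ) ≤ 2 * x := (Nat.floor_le (by linarith)).trans hy2x
    have h3 : (Nat.sqrt Y : ℝ) ≤ Real.sqrt (2 * x) := by
      rw [Real.le_sqrt (by positivity) (by positivity)]; linarith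
    calc (Nat.sqrt Y : ℝ) ≤ Real.sqrt (2 * x) := h3
      _ = Real.sqrt 2 * Real.sqrt x := Real.sqrt_mul (by norm_num) x
      _ ≤ 2 * Real.exp (L / 2) := by
          rw [hsqrtx]
          gcongr
          rw [Real.sqrt_le_left (by norm_num)]; norm_num
  -- `(1 + log sqrt Y) ≤ 2L`
  have hlog : 1 + Real.log (Nat.sqrt Y) ≤ 2 * L := by
    have h1 : Real.log (Nat.sqrt Y) ≤ Real.log (2 * Real.exp (L / 2)) :=
      Real.log_le_log (by exact_mod_cast hsY1) hsY
    rw [Real.log_mul (by norm_num) (Real.exp_ne_zero _), Real.log_exp] at h1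
    have h2 : Real.log 2 ≤ 1 := by
      have := Real.log_two_lt_d9; norm_num at this; linarith
    linarith
  have hlog0 : 0 ≤ 1 + Real.log (Nat.sqrt Y) := by
    have : 0 ≤ Real.log (Nat.sqrt Y) := Real.log_nonneg (by exact_mod_cast hsY1)
    linarith
  have hL0 : 0 < L := by linarith
  have hA0 : 0 ≤ A := by linarith
  refine h.trans ?_
  calc A * (((Y - X : ℕ) : ℝ) + Nat.sqrt Y) * (1 + Real.log (Nat.sqrt Y)) ^ k
      ≤ A * ((η * x + 1) + 2 * Real.exp (L / 2)) * (2 * L) ^ k :=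
        mul_le_mul (mul_le_mul_of_nonneg_left (add_le_add hYX hsY) hA0)
          (pow_le_pow_left₀ hlog0 hlog k) (pow_nonneg hlog0 k) (mul_nonneg hA0 (by positivity))
    _ ≤ A * (η * x + 3 * Real.exp (L / 2)) * (2 * L) ^ k := by
        have : 1 ≤ Real.exp (L / 2) := Real.one_le_exp (by linarith)
        have h0 : 0 ≤ (2 * L) ^ k := by positivity
        have : A * ((η * x + 1) + 2 * Real.exp (L / 2)) ≤ A * (η * x + 3 * Real.exp (L / 2)) := by
          refine mul_le_mul_of_nonneg_left ?_ (by linarith); linarith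
        exact mul_le_mul_of_nonneg_right this h0
    _ = A * 2 ^ k * (η * x + 3 * (Real.exp (-(L / 2)) * x)) * L ^ k := by
        rw [hexpx, mul_pow]; ring

/-! ### The Selberg–Delange mean value of `z^{ω(n)}` (plain partial sums) -/

set_option maxHeartbeats 4000000 in
/-- **Selberg's mean value of `z^{ω(n)}` (Montgomery–Vaughan, Theorem 7.18 with the Euler
product of §7.4.1 Exercise 3(a)–(b); Selberg 1954), plain partial sums.** For every `R > 0` there
are `C` and `L₀` such that for `L ≥ L₀`, `x = e^L` and `‖z‖ ≤ R`,

  `‖Σ_{n ≤ x} z^{ω(n)} − F(1,z) Γ(z)⁻¹ x (log x)^{z−1}‖ ≤ C x (log x)^{Re z − 2}`.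

Proof (de-smoothing the Riesz means of `SatheSelbergRieszMeans.lean` by an averaged difference,
instead of the truncated Perron formula of the printed proof of Theorem 7.17): with `h = ηx`,
`η = e^{−(c̄/4)√L}`, `A_z(x) = (I_z(x+h) − I_z(x))/h − h⁻¹ Σ_{x<n≤x+h} z^{ω(n)}(x+h−n)`
(`rieszMean_sub_rieszMean`); both Riesz means are Perron integrals (order one) deformed onto the
SAME keyhole contour attached to `L` (`exists_norm_line_sub_keyhole_le`: the far pieces are
`O(x² L^R e^{−c̄√L})`, harmless after division by `h`); the difference of the two keyhole integrals
is `η F(1,z) x² L^{z−1} (2πi/Γ(z) + O(e^{−β/2})) + O(η x² L^{Re z−2})`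
(`exists_norm_keyhole_diff_le`, Hankel's formula `Keyhole.hankelLoop_sub_le`); and the short sum is
`O((h + √x) L^k)` (`sum_short_le`). [cite: MontgomeryVaughan2007, §7.4 Theorems 7.17–7.18 and
§7.4.1 Exercise 3(a)–(b)] -/
theorem omegaCoeff_sum_asymp (R : ℝ) (hR : 0 < R) :
    ∃ C : ℝ, 0 ≤ C ∧ ∃ L₀ : ℝ, 1 ≤ L₀ ∧ ∀ L : ℝ, L₀ ≤ L → ∀ z : ℂ, ‖z‖ ≤ R →
      ‖(∑ n ∈ Finset.Ioc 0 ⌊Real.exp L⌋₊, omegaCoeff z n) -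
        selbergF 1 z * (Complex.Gamma z)⁻¹ * ((Real.exp L : ℝ) : ℂ) * (L : ℂ) ^ (z - 1)‖ ≤
        C * Real.exp L * L ^ (z.re - 2) := by
  -- constants
  obtain ⟨Cfar, hCfar, hfar⟩ := exists_norm_line_sub_keyhole_le R hR
  obtain ⟨Ckey, hCkey, hkeyd⟩ := exists_norm_keyhole_diff_le R hR
  obtain ⟨CH, hCH, hHankel⟩ := Literature.Analysis.Complex.Keyhole.hankelLoop_sub_le R
  obtain ⟨B, hB, hFb⟩ := exists_bound_selbergF (by norm_num : (1 : ℝ) / 2 < 3 / 4) R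
  have hc := zfrConst_pos
  have hcle := zfrConst_le
  set A : ℝ := max R 1 with hAdef
  have hA1 : 1 ≤ A := le_max_right _ _
  have hA0 : 0 ≤ A := by linarith
  have hRA : R ≤ A := le_max_left _ _
  set k : ℕ := ⌈A ^ 2⌉₊ with hkdef
  have hAk : A ^ 2 ≤ k := Nat.le_ceil _
  set ρ₁ : ℝ := min (1 / 4) (zfrWidth 1 / 2) with hρ₁
  have hρ₁pos : 0 < ρ₁ := lt_min (by norm_num) (by linarith [zfrWidth_pos 1])
  obtain ⟨Ca, hCa, hdeca⟩ := exists_rpow_le_exp_sqrt (2 * R + 2) (c := 3 / 4 * zfrConst) (by positivity)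
  obtain ⟨Cb, hCb, hdecb⟩ := exists_rpow_le_exp_sqrt 1 (c := zfrConst / 2) (by positivity)
  obtain ⟨Cc, hCc, hdecc⟩ := exists_rpow_le_exp_sqrt (k + R + 2) (c := zfrConst / 4) (by positivity)
  obtain ⟨Cd, hCd, hdecd⟩ := exists_rpow_le_exp_sqrt 2 (c := zfrConst / 4) (by positivity)
  set CONST : ℝ := 1 / (2 * π) * (5 * Cfar * Ca + B * CH * Cb + Ckey) + A * 2 ^ k * 4 * Cc with hCONST
  set L₀ : ℝ := max (max (max 4 (1 / zfrConst ^ 2)) (max ((16 * zfrConst / ρ₁) ^ 2) (8 / ρ₁))) Cd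
    with hL₀
  have hL₀4 : 4 ≤ L₀ := le_trans (le_max_left _ _) ((le_max_left _ _).trans (le_max_left _ _))
  refine ⟨CONST, by positivity, L₀, by linarith, fun L hL z hz ↦ ?_⟩
  -- thresholds
  have hL4 : 4 ≤ L := hL₀4.trans hL
  have hLc : 1 / zfrConst ^ 2 ≤ L :=
    le_trans ((le_max_right _ _).trans ((le_max_left _ _).trans (le_max_left _ _))) hL
  have hLρ1 : (16 * zfrConst / ρ₁) ^ 2 ≤ L :=
    le_trans ((le_max_left _ _).trans ((le_max_right _ _).trans (le_max_left _ _))) hL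
  have hLρ2 : 8 / ρ₁ ≤ L :=
    le_trans ((le_max_right _ _).trans ((le_max_right _ _).trans (le_max_left _ _))) hL
  have hLd : Cd ≤ L := le_trans (le_max_right _ _) hL
  have hL1 : 1 ≤ L := by linarith
  have hL0 : 0 < L := by linarith
  obtain ⟨hT3, hℓ1, hℓ2, hsqrt2, hsqrtL⟩ := params hL4
  -- parameters
  set x : ℝ := Real.exp L with hxdef
  have hx0 : 0 < x := Real.exp_pos L
  have hx1 : 1 ≤ x := Real.one_le_exp (by linarith)
  set η : ℝ := Real.exp (-(zfrConst / 4 * Real.sqrt L)) with hηdef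
  have hη0 : 0 < η := Real.exp_pos _
  have hη1 : η ≤ 1 := by rw [hηdef, Real.exp_le_one_iff]; have := Real.sqrt_nonneg L; nlinarith
  have hηL : η * L ≤ 1 := by
    -- `L² ≤ Cd e^{(c̄/4)√L}` and `L ≥ Cd`
    have h1 := hdecd L hL1
    have h2 : η * L ^ (2 : ℝ) ≤ Cd := by
      rw [hηdef]
      calc Real.exp (-(zfrConst / 4 * Real.sqrt L)) * L ^ (2 : ℝ)
          ≤ Real.exp (-(zfrConst / 4 * Real.sqrt L)) * (Cd * Real.exp (zfrConst / 4 * Real.sqrt L)) :=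
            mul_le_mul_of_nonneg_left h1 (Real.exp_pos _).le
        _ = Cd := by rw [Real.exp_neg]; field_simp
    have h3 : L ^ (2 : ℝ) = L * L := by
      rw [show (2 : ℝ) = ((2 : ℕ) : ℝ) by norm_num, Real.rpow_natCast, sq]
    rw [h3] at h2
    have h4 : η * L * L ≤ 1 * L := by nlinarith
    exact le_of_mul_le_mul_right h4 hL0
  set y₂ : ℝ := (1 + η) * x with hy₂
  have hxy : x ≤ y₂ := by rw [hy₂]; nlinarith
  have hy2x : y₂ ≤ 2 * x := by rw [hy₂]; nlinarith
  have hy₂0 : 0 < y₂ := by linarith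
  set a : ℝ := 1 + 1 / L with ha
  set δ : ℝ := 1 / L with hδ
  set T : ℝ := Real.exp (Real.sqrt L) with hT
  set ℓ : ℝ := Real.log (T + 3) with hℓ
  set β : ℝ := 2 * zfrConst * L / ℓ with hβ
  have ha1 : 1 < a := by rw [ha]; linarith [show (0 : ℝ) < 1 / L by positivity]
  have hℓ0 : 0 < ℓ := by linarith
  -- `β ≥ c̄ √L ≥ 1` and the keyhole fits in the disc
  have hβge : zfrConst * Real.sqrt L ≤ β := by
    rw [hβ, le_div_iff₀ hℓ0]
    have hsq : Real.sqrt L * Real.sqrt L = L := Real.mul_self_sqrt hL0.le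
    calc zfrConst * Real.sqrt L * ℓ ≤ zfrConst * Real.sqrt L * (2 * Real.sqrt L) :=
          mul_le_mul_of_nonneg_left hℓ2 (by positivity)
      _ = 2 * zfrConst * L := by
          rw [show zfrConst * Real.sqrt L * (2 * Real.sqrt L) =
            2 * zfrConst * (Real.sqrt L * Real.sqrt L) by ring, hsq]
  have hβ1 : 1 ≤ β := by
    refine le_trans ?_ hβge
    have h1 : 1 / zfrConst ≤ Real.sqrt L := by
      rw [Real.le_sqrt' (by positivity)]; rwa [div_pow, one_pow]
    calc (1 : ℝ) = zfrConst * (1 / zfrConst) := by field_simp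
      _ ≤ zfrConst * Real.sqrt L := mul_le_mul_of_nonneg_left h1 hc.le
  have hβle : β ≤ 2 * zfrConst * Real.sqrt L := by
    rw [hβ, div_le_iff₀ hℓ0]
    have hsq : Real.sqrt L * Real.sqrt L = L := Real.mul_self_sqrt hL0.le
    calc 2 * zfrConst * L = 2 * zfrConst * Real.sqrt L * Real.sqrt L := by
          rw [mul_assoc (2 * zfrConst) (Real.sqrt L), hsq]
      _ ≤ 2 * zfrConst * Real.sqrt L * ℓ := mul_le_mul_of_nonneg_left hℓ1 (by positivity)
  have hfit : (β + 1) / L ≤ ρ₁ / 4 := by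
    have hsqpos : 0 < Real.sqrt L := by linarith
    have h1 : β / L ≤ ρ₁ / 8 := by
      have h2 : β / L ≤ 2 * zfrConst / Real.sqrt L := by
        rw [div_le_div_iff₀ hL0 hsqpos]
        have hsq : Real.sqrt L * Real.sqrt L = L := Real.mul_self_sqrt hL0.le
        calc β * Real.sqrt L ≤ 2 * zfrConst * Real.sqrt L * Real.sqrt L :=
              mul_le_mul_of_nonneg_right hβle hsqpos.le
          _ = 2 * zfrConst * L := by rw [mul_assoc (2 * zfrConst) (Real.sqrt L), hsq]
      have h3 : 2 * zfrConst / Real.sqrt L ≤ ρ₁ / 8 := by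
        rw [div_le_div_iff₀ hsqpos (by norm_num)]
        have h4 : 16 * zfrConst / ρ₁ ≤ Real.sqrt L := by
          rw [Real.le_sqrt' (by positivity)]; exact hLρ1
        rw [div_le_iff₀ hρ₁pos] at h4
        linarith
      exact h2.trans h3
    have h2 : 1 / L ≤ ρ₁ / 8 := by
      rw [div_le_iff₀ hL0]; rw [div_le_iff₀ hρ₁pos] at hLρ2; linarith
    rw [add_div]; linarith
  ------------------------------------------------------------------
  -- the two integrands, Perron, the far pieces, the keyhole difference
  ------------------------------------------------------------------
  set Ψ₁ : ℂ → ℂ := fun s ↦ (x : ℂ) ^ (1 + s) *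
    (selbergF s z * exp (z * (logZeta₁ s - log (s - 1)))) * kernel s with hΨ₁def
  set Ψ₂ : ℂ → ℂ := fun s ↦ (y₂ : ℂ) ^ (1 + s) *
    (selbergF s z * exp (z * (logZeta₁ s - log (s - 1)))) * kernel s with hΨ₂def
  have hΨ₁ : ∀ s, Ψ₁ s = (x : ℂ) ^ (1 + s) *
      (selbergF s z * exp (z * (logZeta₁ s - log (s - 1)))) * kernel s := fun s ↦ rfl
  have hΨ₂ : ∀ s, Ψ₂ s = (y₂ : ℂ) ^ (1 + s) *
      (selbergF s z * exp (z * (logZeta₁ s - log (s - 1)))) * kernel s := fun s ↦ rfl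
  set J₁ : ℂ := ∫ t : ℝ, Ψ₁ ((a : ℂ) + t * I) with hJ₁
  set J₂ : ℂ := ∫ t : ℝ, Ψ₂ ((a : ℂ) + t * I) with hJ₂
  set S₁ : ℂ := ∑ n ∈ Finset.Ioc 0 ⌊x⌋₊, omegaCoeff z n * ((x : ℂ) - n) with hS₁
  set S₂ : ℂ := ∑ n ∈ Finset.Ioc 0 ⌊y₂⌋₊, omegaCoeff z n * ((y₂ : ℂ) - n) with hS₂
  set Az : ℂ := ∑ n ∈ Finset.Ioc 0 ⌊x⌋₊, omegaCoeff z n with hAz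
  set Sshort : ℂ := ∑ n ∈ Finset.Ioc ⌊x⌋₊ ⌊y₂⌋₊, omegaCoeff z n * ((y₂ : ℂ) - n) with hSshort
  have hP1 : S₁ = (1 / (2 * π) : ℂ) * J₁ := rieszMean_eq_integral hx0 z ha1
  have hP2 : S₂ = (1 / (2 * π) : ℂ) * J₂ := rieszMean_eq_integral hy₂0 z ha1
  have harith : S₂ - S₁ = ((y₂ - x : ℝ) : ℂ) * Az + Sshort := rieszMean_sub_rieszMean hxy z
  have hyx : y₂ - x = η * x := by rw [hy₂]; ring
  -- far pieces
  set D₁ : ℂ := I * J₁ - keyhole Ψ₁ (1 - β / L) (1 + 1 / L) (1 / L) with hD₁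
  set D₂ : ℂ := I * J₂ - keyhole Ψ₂ (1 - β / L) (1 + 1 / L) (1 / L) with hD₂
  have hD₁le : ‖D₁‖ ≤ Cfar * x ^ 2 * L ^ R * Real.exp (-(zfrConst * Real.sqrt L)) :=
    hfar L hL4 hLc x le_rfl (by linarith) z hz β rfl Ψ₁ hΨ₁
  have hD₂le : ‖D₂‖ ≤ Cfar * y₂ ^ 2 * L ^ R * Real.exp (-(zfrConst * Real.sqrt L)) :=
    hfar L hL4 hLc y₂ hxy (by linarith) z hz β rfl Ψ₂ hΨ₂
  -- keyhole difference
  set Main : ℂ := selbergF 1 z * ((x : ℂ) ^ 2 * (L : ℂ) ^ (z - 1) * hankelLoop β z) with hMain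
  set Kerr : ℂ := keyhole Ψ₂ (1 - β / L) (1 + 1 / L) (1 / L) - keyhole Ψ₁ (1 - β / L) (1 + 1 / L) (1 / L) -
    η * Main with hKerr
  have hKerr_le : ‖Kerr‖ ≤ Ckey * η * x ^ 2 * L ^ (z.re - 2) := by
    have h := hkeyd L hL4 η hη0 hηL β hβ1 hfit z hz Ψ₁ Ψ₂ hΨ₁ (fun s ↦ by rw [hΨ₂ s, hy₂])
    exact h
  -- Hankel's formula
  set Herr : ℂ := hankelLoop β z - 2 * π * I / Complex.Gamma z with hHerr
  have hHerr_le : ‖Herr‖ ≤ CH * Real.exp (-β / 2) := hHankel β hβ1 z hz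
  ------------------------------------------------------------------
  -- the identity
  ------------------------------------------------------------------
  have hπ : (π : ℂ) ≠ 0 := ofReal_ne_zero.2 Real.pi_ne_zero
  have hηC : (η : ℂ) ≠ 0 := ofReal_ne_zero.2 hη0.ne'
  have hxC : (x : ℂ) ≠ 0 := ofReal_ne_zero.2 hx0.ne'
  have hπne : (π : ℝ) ≠ 0 := Real.pi_ne_zero
  have hηne : η ≠ 0 := hη0.ne'
  have hxne : x ≠ 0 := hx0.ne'
  have hJ1 : J₁ = 2 * π * S₁ := by rw [hP1]; field_simp
  have hJ2 : J₂ = 2 * π * S₂ := by rw [hP2]; field_simp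
  set Err : ℂ := (D₂ - D₁) + η * (selbergF 1 z * ((x : ℂ) ^ 2 * (L : ℂ) ^ (z - 1))) * Herr + Kerr
    with hErr
  have hident : (2 * π * I * η * x) * (Az - selbergF 1 z * (Complex.Gamma z)⁻¹ * (x : ℂ) * (L : ℂ) ^ (z - 1)) =
      Err - 2 * π * I * Sshort := by
    have hD : D₂ - D₁ = I * (J₂ - J₁) -
        (keyhole Ψ₂ (1 - β / L) (1 + 1 / L) (1 / L) - keyhole Ψ₁ (1 - β / L) (1 + 1 / L) (1 / L)) := by
      rw [hD₂, hD₁]; ring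
    have hK : keyhole Ψ₂ (1 - β / L) (1 + 1 / L) (1 / L) - keyhole Ψ₁ (1 - β / L) (1 + 1 / L) (1 / L) =
        Kerr + η * Main := by rw [hKerr]; ring
    have hH : hankelLoop β z = Herr + 2 * π * I * (Complex.Gamma z)⁻¹ := by
      rw [hHerr, div_eq_mul_inv]; ring
    have hyxC : ((y₂ - x : ℝ) : ℂ) = η * x := by rw [hyx]; push_cast; ring
    rw [hErr, hD, hK, hMain, hH, hJ1, hJ2, show (2 : ℂ) * π * S₂ - 2 * π * S₁ = 2 * π * (S₂ - S₁) by ring,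
      harith, hyxC]
    ring
  have hcoef : (2 * π * I * η * x : ℂ) ≠ 0 :=
    mul_ne_zero (mul_ne_zero (mul_ne_zero (mul_ne_zero two_ne_zero hπ) I_ne_zero) hηC) hxC
  have hfinal : Az - selbergF 1 z * (Complex.Gamma z)⁻¹ * (x : ℂ) * (L : ℂ) ^ (z - 1) =
      (2 * π * I * η * x : ℂ)⁻¹ * (Err - 2 * π * I * Sshort) := by
    rw [← hident, ← mul_assoc, inv_mul_cancel₀ hcoef, one_mul]
  ------------------------------------------------------------------
  -- the bounds
  ------------------------------------------------------------------
  have hLRe0 : 0 ≤ L ^ (z.re - 2) := Real.rpow_nonneg hL0.le _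
  have hRez : -(R + 2) ≤ z.re - 2 := by linarith [neg_le_abs z.re, abs_re_le_norm z]
  have hLRe : L ^ (-(R + 2)) ≤ L ^ (z.re - 2) := Real.rpow_le_rpow_of_exponent_le hL1 hRez
  set E : ℝ := Real.exp (-(zfrConst * Real.sqrt L)) with hE
  -- (a) far pieces: `L^R E/η ≤ Ca L^{Re z − 2}`
  have hfar_dec : L ^ R * E / η ≤ Ca * L ^ (z.re - 2) := by
    have h1 : E / η = Real.exp (-(3 / 4 * zfrConst * Real.sqrt L)) := by
      rw [hE, hηdef, ← Real.exp_sub]; congr 1; ring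
    have h2 : Real.exp (-(3 / 4 * zfrConst * Real.sqrt L)) ≤ Ca * L ^ (-(2 * R + 2)) :=
      exp_neg_le_of_rpow_le hL0 (hdeca L hL1)
    rw [mul_div_assoc, h1]
    calc L ^ R * Real.exp (-(3 / 4 * zfrConst * Real.sqrt L)) ≤ L ^ R * (Ca * L ^ (-(2 * R + 2))) :=
          mul_le_mul_of_nonneg_left h2 (Real.rpow_nonneg hL0.le _)
      _ = Ca * (L ^ R * L ^ (-(2 * R + 2))) := by ring
      _ = Ca * L ^ (-(R + 2)) := by rw [← Real.rpow_add hL0]; congr 2; ring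
      _ ≤ Ca * L ^ (z.re - 2) := mul_le_mul_of_nonneg_left hLRe hCa.le
  have hDsum : ‖D₂ - D₁‖ ≤ 5 * Cfar * x ^ 2 * (L ^ R * E) := by
    have hy4 : y₂ ^ 2 ≤ 4 * x ^ 2 := by nlinarith
    calc ‖D₂ - D₁‖ ≤ ‖D₂‖ + ‖D₁‖ := norm_sub_le _ _
      _ ≤ Cfar * y₂ ^ 2 * L ^ R * E + Cfar * x ^ 2 * L ^ R * E := add_le_add hD₂le hD₁le
      _ ≤ Cfar * (4 * x ^ 2) * L ^ R * E + Cfar * x ^ 2 * L ^ R * E := by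
          have : 0 ≤ L ^ R := Real.rpow_nonneg hL0.le _
          gcongr
      _ = 5 * Cfar * x ^ 2 * (L ^ R * E) := by ring
  have hDterm : ‖D₂ - D₁‖ / (2 * π * η * x) ≤ 1 / (2 * π) * (5 * Cfar * Ca) * x * L ^ (z.re - 2) := by
    rw [div_le_iff₀ (by positivity)]
    calc ‖D₂ - D₁‖ ≤ 5 * Cfar * x ^ 2 * (L ^ R * E) := hDsum
      _ = 5 * Cfar * x ^ 2 * (L ^ R * E / η) * η := by field_simp
      _ ≤ 5 * Cfar * x ^ 2 * (Ca * L ^ (z.re - 2)) * η := by gcongr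
      _ = 1 / (2 * π) * (5 * Cfar * Ca) * x * L ^ (z.re - 2) * (2 * π * η * x) := by
          field_simp
  -- (b) Hankel: `L^{Re z − 1} e^{−β/2} ≤ Cb L^{Re z − 2}`
  have hHterm : ‖(η : ℂ) * (selbergF 1 z * ((x : ℂ) ^ 2 * (L : ℂ) ^ (z - 1))) * Herr‖ / (2 * π * η * x) ≤
      1 / (2 * π) * (B * CH * Cb) * x * L ^ (z.re - 2) := by
    have h1 : ‖(η : ℂ) * (selbergF 1 z * ((x : ℂ) ^ 2 * (L : ℂ) ^ (z - 1))) * Herr‖ ≤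
        η * (B * (x ^ 2 * L ^ (z.re - 1))) * (CH * Real.exp (-β / 2)) := by
      rw [norm_mul, norm_mul, norm_mul, norm_mul, Complex.norm_real, Real.norm_of_nonneg hη0.le,
        norm_pow, Complex.norm_real, Real.norm_of_nonneg hx0.le, norm_cpow_eq_rpow_re_of_pos hL0,
        sub_re, one_re]
      have : 0 ≤ x ^ 2 * L ^ (z.re - 1) := by
        have := Real.rpow_nonneg hL0.le (z.re - 1); positivity
      gcongr
      exact hFb 1 z (by norm_num) hz
    have h2 : Real.exp (-β / 2) ≤ Cb * L ^ (-(1 : ℝ)) := by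
      have h3 : Real.exp (-(zfrConst / 2 * Real.sqrt L)) ≤ Cb * L ^ (-(1 : ℝ)) :=
        exp_neg_le_of_rpow_le hL0 (hdecb L hL1)
      refine le_trans (Real.exp_le_exp.2 ?_) h3
      linarith
    have h4 : L ^ (z.re - 1) * L ^ (-(1 : ℝ)) = L ^ (z.re - 2) := by
      rw [← Real.rpow_add hL0]; congr 1; ring
    rw [div_le_iff₀ (by positivity)]
    calc ‖(η : ℂ) * (selbergF 1 z * ((x : ℂ) ^ 2 * (L : ℂ) ^ (z - 1))) * Herr‖
        ≤ η * (B * (x ^ 2 * L ^ (z.re - 1))) * (CH * Real.exp (-β / 2)) := h1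
      _ ≤ η * (B * (x ^ 2 * L ^ (z.re - 1))) * (CH * (Cb * L ^ (-(1 : ℝ)))) := by
          have : 0 ≤ L ^ (z.re - 1) := Real.rpow_nonneg hL0.le _
          gcongr
      _ = 1 / (2 * π) * (B * CH * Cb) * x * (L ^ (z.re - 1) * L ^ (-(1 : ℝ))) * (2 * π * η * x) := by
          field_simp
      _ = 1 / (2 * π) * (B * CH * Cb) * x * L ^ (z.re - 2) * (2 * π * η * x) := by rw [h4]
  -- (c) keyhole difference
  have hKterm : ‖Kerr‖ / (2 * π * η * x) ≤ 1 / (2 * π) * Ckey * x * L ^ (z.re - 2) := by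
    rw [div_le_iff₀ (by positivity)]
    calc ‖Kerr‖ ≤ Ckey * η * x ^ 2 * L ^ (z.re - 2) := hKerr_le
      _ = 1 / (2 * π) * Ckey * x * L ^ (z.re - 2) * (2 * π * η * x) := by field_simp
  -- (d) the short sum
  have hshort : ‖Sshort‖ / (η * x) ≤ A * 2 ^ k * 4 * Cc * x * L ^ (z.re - 2) := by
    have hzA : ‖z‖ ≤ A := hz.trans hRA
    have h1 : ‖Sshort‖ ≤ (y₂ - x) * ∑ n ∈ Finset.Ioc ⌊x⌋₊ ⌊y₂⌋₊, A ^ (ω n) :=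
      norm_shortSum_le hx0.le hxy hzA
    have h2 := sum_short_le hA1 hAk hL4 hη0.le hη1
    rw [← hxdef] at h2
    rw [← hy₂] at h2
    -- decay: `η L^k ≤ Cc L^{-R-2}` and `e^{-L/2} ≤ η`
    have h3 : η * L ^ k ≤ Cc * L ^ (z.re - 2) := by
      have h4 : Real.exp (-(zfrConst / 4 * Real.sqrt L)) ≤ Cc * L ^ (-((k : ℝ) + R + 2)) :=
        exp_neg_le_of_rpow_le hL0 (hdecc L hL1)
      rw [hηdef]
      calc Real.exp (-(zfrConst / 4 * Real.sqrt L)) * L ^ k ≤ Cc * L ^ (-((k : ℝ) + R + 2)) * L ^ k :=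
            mul_le_mul_of_nonneg_right h4 (by positivity)
        _ = Cc * (L ^ (-((k : ℝ) + R + 2)) * L ^ (k : ℝ)) := by rw [Real.rpow_natCast]; ring
        _ = Cc * L ^ (-(R + 2)) := by rw [← Real.rpow_add hL0]; congr 2; ring
        _ ≤ Cc * L ^ (z.re - 2) := mul_le_mul_of_nonneg_left hLRe hCc.le
    have h5 : Real.exp (-(L / 2)) ≤ η := by
      rw [hηdef, Real.exp_le_exp]
      have : zfrConst / 4 * Real.sqrt L ≤ L / 2 := by
        calc zfrConst / 4 * Real.sqrt L ≤ zfrConst / 4 * L := by gcongr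
          _ ≤ L / 2 := by nlinarith
      linarith
    rw [hyx] at h1
    rw [div_le_iff₀ (by positivity)]
    calc ‖Sshort‖ ≤ η * x * ∑ n ∈ Finset.Ioc ⌊x⌋₊ ⌊y₂⌋₊, A ^ (ω n) := h1
      _ ≤ η * x * (A * 2 ^ k * (η * x + 3 * (Real.exp (-(L / 2)) * x)) * L ^ k) := by gcongr
      _ ≤ η * x * (A * 2 ^ k * (η * x + 3 * (η * x)) * L ^ k) := by gcongr
      _ = A * 2 ^ k * 4 * x * (η * L ^ k) * (η * x) := by ring
      _ ≤ A * 2 ^ k * 4 * x * (Cc * L ^ (z.re - 2)) * (η * x) := by gcongr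
      _ = A * 2 ^ k * 4 * Cc * x * L ^ (z.re - 2) * (η * x) := by ring
  ------------------------------------------------------------------
  -- conclusion
  ------------------------------------------------------------------
  rw [hfinal, norm_mul, norm_inv]
  have hnc : ‖(2 * π * I * η * x : ℂ)‖ = 2 * π * η * x := by
    rw [norm_mul, norm_mul, norm_mul, norm_mul, Complex.norm_I, Complex.norm_two, Complex.norm_real,
      Complex.norm_real, Complex.norm_real, Real.norm_of_nonneg Real.pi_pos.le,
      Real.norm_of_nonneg hη0.le, Real.norm_of_nonneg hx0.le]
    ring
  rw [hnc]
  have hErr_le : ‖Err - 2 * π * I * Sshort‖ ≤ ‖D₂ - D₁‖ +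
      ‖(η : ℂ) * (selbergF 1 z * ((x : ℂ) ^ 2 * (L : ℂ) ^ (z - 1))) * Herr‖ + ‖Kerr‖ + 2 * π * ‖Sshort‖ := by
    have h2πS : ‖2 * π * I * Sshort‖ = 2 * π * ‖Sshort‖ := by
      rw [norm_mul, norm_mul, norm_mul, Complex.norm_I, Complex.norm_two, Complex.norm_real,
        Real.norm_of_nonneg Real.pi_pos.le]; ring
    calc ‖Err - 2 * π * I * Sshort‖ ≤ ‖Err‖ + ‖2 * π * I * Sshort‖ := norm_sub_le _ _
      _ ≤ (‖D₂ - D₁‖ + ‖(η : ℂ) * (selbergF 1 z * ((x : ℂ) ^ 2 * (L : ℂ) ^ (z - 1))) * Herr‖ + ‖Kerr‖) +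
            2 * π * ‖Sshort‖ := by
          rw [h2πS, hErr]
          exact add_le_add ((norm_add_le _ _).trans (add_le_add (norm_add_le _ _) le_rfl)) le_rfl
      _ = _ := by ring
  have hpos : 0 < 2 * π * η * x := by positivity
  calc (2 * π * η * x)⁻¹ * ‖Err - 2 * π * I * Sshort‖
      ≤ (2 * π * η * x)⁻¹ * (‖D₂ - D₁‖ +
          ‖(η : ℂ) * (selbergF 1 z * ((x : ℂ) ^ 2 * (L : ℂ) ^ (z - 1))) * Herr‖ + ‖Kerr‖ + 2 * π * ‖Sshort‖) :=
        mul_le_mul_of_nonneg_left hErr_le (by positivity)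
    _ = ‖D₂ - D₁‖ / (2 * π * η * x) +
          ‖(η : ℂ) * (selbergF 1 z * ((x : ℂ) ^ 2 * (L : ℂ) ^ (z - 1))) * Herr‖ / (2 * π * η * x) +
          ‖Kerr‖ / (2 * π * η * x) + ‖Sshort‖ / (η * x) := by
        field_simp
    _ ≤ 1 / (2 * π) * (5 * Cfar * Ca) * x * L ^ (z.re - 2) + 1 / (2 * π) * (B * CH * Cb) * x * L ^ (z.re - 2) +
          1 / (2 * π) * Ckey * x * L ^ (z.re - 2) + A * 2 ^ k * 4 * Cc * x * L ^ (z.re - 2) :=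
        add_le_add (add_le_add (add_le_add hDterm hHterm) hKterm) hshort
    _ = CONST * x * L ^ (z.re - 2) := by rw [hCONST]; ring


/-! ### From `x = e^L` to integers `x ≥ 2` and the finite Euler product `F_x(z)` -/

/-- The mean value at large integers `x`, with the finite Euler product `F_x(z) = satheSelbergFC x z`
in the main term (`F(1,z) − F_x(z) = O_R(x^{-1/2})`, `exists_norm_selbergF_one_sub_prod_le`).
[cite: MontgomeryVaughan2007, Theorem 7.18 and §7.4.1 Exercise 3(a),(b)] -/
theorem omegaMeanValue_large (R : ℝ) (hR : 0 < R) :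
    ∃ C : ℝ, 0 ≤ C ∧ ∃ x₁ : ℕ, ∀ x : ℕ, x₁ ≤ x → ∀ z : ℂ, ‖z‖ ≤ R →
      ‖(∑ n ∈ Finset.Icc 1 x, z ^ (ArithmeticFunction.cardDistinctFactors n)) -
          satheSelbergFC x z / Complex.Gamma z * (x : ℂ) * ((Real.log x : ℂ) ^ (z - 1))‖ ≤
        C * (x : ℝ) * Real.log x ^ (z.re - 2) := by
  obtain ⟨C₀, hC₀, L₀, hL₀, hmain⟩ := omegaCoeff_sum_asymp R hR
  obtain ⟨M, hM0, hM⟩ := exists_bound_satheSelbergFC R hR.le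
  obtain ⟨D, hD0, x₀, hD⟩ := exists_norm_selbergF_one_sub_prod_le R
  have hΓc : ContinuousOn (fun w : ℂ ↦ (Complex.Gamma w)⁻¹) (closedBall 0 R) :=
    Complex.differentiable_one_div_Gamma.continuous.continuousOn
  obtain ⟨MΓ, hMΓ⟩ := (isCompact_closedBall (0 : ℂ) R).exists_bound_of_continuousOn hΓc
  have hMΓ0 : 0 ≤ MΓ := (norm_nonneg _).trans (hMΓ 0 (mem_closedBall_self hR.le))
  set x₁ : ℕ := max (max x₀ 2) (⌈Real.exp L₀⌉₊) with hx₁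
  set K : ℝ := M * D with hK
  refine ⟨C₀ + 2 * K * MΓ, by positivity, x₁, fun x hx z hz ↦ ?_⟩
  have hx₀ : x₀ ≤ x := le_trans ((le_max_left _ _).trans (le_max_left _ _)) hx
  have hx2 : 2 ≤ x := le_trans ((le_max_right _ _).trans (le_max_left _ _)) hx
  have hxL₀ : Real.exp L₀ ≤ x := le_trans (Nat.le_ceil _) (by exact_mod_cast (le_max_right _ _).trans hx)
  have hxpos : (0 : ℝ) < x := by exact_mod_cast (by omega : 0 < x)
  have hL : L₀ ≤ Real.log x := by
    rw [← Real.log_exp L₀]; exact Real.log_le_log (Real.exp_pos _) hxL₀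
  have hL0 : 0 < Real.log x := by linarith
  -- the theorem at `L = log x`
  have h := hmain (Real.log x) hL z hz
  rw [Real.exp_log hxpos, Nat.floor_natCast] at h
  have hsum : ∑ n ∈ Finset.Ioc 0 x, omegaCoeff z n =
      ∑ n ∈ Finset.Icc 1 x, z ^ (ArithmeticFunction.cardDistinctFactors n) := by
    rw [show (1 : ℕ) = 0 + 1 from rfl, Finset.Icc_add_one_left_eq_Ioc]; rfl
  rw [hsum] at h
  -- the tail `‖F(1,z) − F_x(z)‖ ≤ K x^{-1/2}`
  have htail : ‖selbergF 1 z - satheSelbergFC x z‖ ≤ K * (x : ℝ) ^ (-(1 / 2 : ℝ)) := by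
    have h1 := hD x hx₀ z hz
    rw [prod_eulerFactor_one_eq_satheSelbergFC] at h1
    calc _ ≤ ‖satheSelbergFC x z‖ * (D * (x : ℝ) ^ (-(1 / 2 : ℝ))) := h1
      _ ≤ M * (D * (x : ℝ) ^ (-(1 / 2 : ℝ))) := by gcongr; exact hM x z hz
      _ = K * (x : ℝ) ^ (-(1 / 2 : ℝ)) := by rw [hK]; ring
  -- the difference of the two main terms
  set A : ℂ := ∑ n ∈ Finset.Icc 1 x, z ^ (ArithmeticFunction.cardDistinctFactors n) with hA
  set P : ℂ := (x : ℂ) * ((Real.log x : ℂ) ^ (z - 1)) with hP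
  have hPn : ‖P‖ = x * Real.log x ^ (z.re - 1) := by
    rw [hP, norm_mul, Complex.norm_natCast, Complex.norm_cpow_eq_rpow_re_of_pos hL0]
    simp
  have e1 : selbergF 1 z * (Complex.Gamma z)⁻¹ * (((x : ℕ) : ℝ) : ℂ) * ((Real.log x : ℝ) : ℂ) ^ (z - 1) =
      selbergF 1 z * (Complex.Gamma z)⁻¹ * P := by rw [hP, Complex.ofReal_natCast]; ring
  have e2 : satheSelbergFC x z / Complex.Gamma z * (x : ℂ) * ((Real.log x : ℂ) ^ (z - 1)) =
      satheSelbergFC x z * (Complex.Gamma z)⁻¹ * P := by rw [hP, div_eq_mul_inv]; ring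
  rw [e1] at h
  rw [e2]
  have hsplit : A - satheSelbergFC x z * (Complex.Gamma z)⁻¹ * P =
      (A - selbergF 1 z * (Complex.Gamma z)⁻¹ * P) +
        (selbergF 1 z - satheSelbergFC x z) * (Complex.Gamma z)⁻¹ * P := by ring
  rw [hsplit]
  refine (norm_add_le _ _).trans ?_
  have hz' : z ∈ closedBall (0 : ℂ) R := by simpa using hz
  have hsecond : ‖(selbergF 1 z - satheSelbergFC x z) * (Complex.Gamma z)⁻¹ * P‖ ≤
      2 * K * MΓ * x * Real.log x ^ (z.re - 2) := by
    rw [norm_mul, norm_mul, hPn]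
    have h1 := htail
    have h2 := hMΓ z hz'
    have hlog : Real.log x ≤ 2 * (x : ℝ) ^ (1 / 2 : ℝ) := by
      have := Real.log_le_rpow_div hxpos.le (by norm_num : (0 : ℝ) < 1 / 2)
      linarith [this]
    have hLpow : Real.log x ^ (z.re - 1) = Real.log x * Real.log x ^ (z.re - 2) := by
      rw [show z.re - 1 = 1 + (z.re - 2) by ring, Real.rpow_add hL0, Real.rpow_one]
    rw [hLpow]
    have hxhalf : (x : ℝ) ^ (-(1 / 2 : ℝ)) * (x : ℝ) ^ (1 / 2 : ℝ) = 1 := by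
      rw [← Real.rpow_add hxpos]; norm_num
    have hL2 : 0 ≤ Real.log x ^ (z.re - 2) := Real.rpow_nonneg hL0.le _
    calc ‖selbergF 1 z - satheSelbergFC x z‖ * ‖(Complex.Gamma z)⁻¹‖ *
          (x * (Real.log x * Real.log x ^ (z.re - 2)))
        ≤ (K * (x : ℝ) ^ (-(1 / 2 : ℝ))) * MΓ * (x * ((2 * (x : ℝ) ^ (1 / 2 : ℝ)) * Real.log x ^ (z.re - 2))) := by
          gcongr
      _ = 2 * K * MΓ * x * Real.log x ^ (z.re - 2) * ((x : ℝ) ^ (-(1 / 2 : ℝ)) * (x : ℝ) ^ (1 / 2 : ℝ)) := by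
          ring
      _ = 2 * K * MΓ * x * Real.log x ^ (z.re - 2) := by rw [hxhalf, mul_one]
  calc ‖A - selbergF 1 z * (Complex.Gamma z)⁻¹ * P‖ + ‖(selbergF 1 z - satheSelbergFC x z) * (Complex.Gamma z)⁻¹ * P‖
      ≤ C₀ * x * Real.log x ^ (z.re - 2) + 2 * K * MΓ * x * Real.log x ^ (z.re - 2) :=
        add_le_add h hsecond
    _ = (C₀ + 2 * K * MΓ) * x * Real.log x ^ (z.re - 2) := by ring

/-- The (trivial) bound at the finitely many small integers `2 ≤ x < x₁`: the left side is a
continuous function of `z` on the compact disc `‖z‖ ≤ R` and `(log x)^{Re z − 2}` is bounded below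
there. [folklore] -/
theorem omegaMeanValue_small (R : ℝ) (x₁ : ℕ) :
    ∃ C : ℝ, 0 ≤ C ∧ ∀ x : ℕ, 2 ≤ x → x < x₁ → ∀ z : ℂ, ‖z‖ ≤ R →
      ‖(∑ n ∈ Finset.Icc 1 x, z ^ (ArithmeticFunction.cardDistinctFactors n)) -
          satheSelbergFC x z / Complex.Gamma z * (x : ℂ) * ((Real.log x : ℂ) ^ (z - 1))‖ ≤
        C * (x : ℝ) * Real.log x ^ (z.re - 2) := by
  -- one `x` at a time
  have hone : ∀ x : ℕ, 2 ≤ x → ∃ C : ℝ, 0 ≤ C ∧ ∀ z : ℂ, ‖z‖ ≤ R →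
      ‖(∑ n ∈ Finset.Icc 1 x, z ^ (ArithmeticFunction.cardDistinctFactors n)) -
          satheSelbergFC x z / Complex.Gamma z * (x : ℂ) * ((Real.log x : ℂ) ^ (z - 1))‖ ≤
        C * (x : ℝ) * Real.log x ^ (z.re - 2) := by
    intro x hx2
    have hxpos : (0 : ℝ) < x := by exact_mod_cast (by omega : 0 < x)
    set ℓ : ℝ := Real.log x with hℓ
    have hℓ0 : 0 < ℓ := Real.log_pos (by exact_mod_cast hx2)
    have hℓC : ((ℓ : ℝ) : ℂ) ≠ 0 := ofReal_ne_zero.2 hℓ0.ne'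
    set f : ℂ → ℂ := fun z ↦ (∑ n ∈ Finset.Icc 1 x, z ^ (ArithmeticFunction.cardDistinctFactors n)) -
      satheSelbergFC x z / Complex.Gamma z * (x : ℂ) * ((Real.log x : ℂ) ^ (z - 1)) with hf
    have hcont : Continuous f := by
      have h1 : Continuous fun z : ℂ ↦ ∑ n ∈ Finset.Icc 1 x, z ^ (ArithmeticFunction.cardDistinctFactors n) :=
        continuous_finsetSum _ fun n _ ↦ continuous_pow _
      have h2 : Continuous fun z : ℂ ↦ satheSelbergFC x z := (differentiable_satheSelbergFC x).continuous
      have h3 : Continuous fun z : ℂ ↦ (Complex.Gamma z)⁻¹ := Complex.differentiable_one_div_Gamma.continuous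
      have h4 : Continuous fun z : ℂ ↦ ((Real.log x : ℂ) ^ (z - 1)) :=
        Continuous.const_cpow (by fun_prop) (Or.inl hℓC)
      have e : f = fun z ↦ (∑ n ∈ Finset.Icc 1 x, z ^ (ArithmeticFunction.cardDistinctFactors n)) -
          satheSelbergFC x z * (Complex.Gamma z)⁻¹ * (x : ℂ) * ((Real.log x : ℂ) ^ (z - 1)) := by
        funext z; simp only [hf, div_eq_mul_inv]
      rw [e]
      exact h1.sub (((h2.mul h3).mul continuous_const).mul h4)
    obtain ⟨M, hM⟩ := (isCompact_closedBall (0 : ℂ) R).exists_bound_of_continuousOn hcont.continuousOn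
    set M' : ℝ := max M 0 with hM'
    set m : ℝ := min (ℓ ^ (-(R + 2))) (ℓ ^ (R - 2)) with hm
    have hm0 : 0 < m := lt_min (Real.rpow_pos_of_pos hℓ0 _) (Real.rpow_pos_of_pos hℓ0 _)
    have hlow : ∀ z : ℂ, ‖z‖ ≤ R → m ≤ ℓ ^ (z.re - 2) := by
      intro z hz
      have hre := abs_re_le_norm z
      rw [abs_le] at hre
      rcases le_or_gt 1 ℓ with h1 | h1
      · calc m ≤ ℓ ^ (-(R + 2)) := min_le_left _ _
          _ ≤ ℓ ^ (z.re - 2) := Real.rpow_le_rpow_of_exponent_le h1 (by linarith)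
      · calc m ≤ ℓ ^ (R - 2) := min_le_right _ _
          _ ≤ ℓ ^ (z.re - 2) := Real.rpow_le_rpow_of_exponent_ge hℓ0 h1.le (by linarith)
    refine ⟨M' / (x * m), by positivity, fun z hz ↦ ?_⟩
    have hz' : z ∈ closedBall (0 : ℂ) R := by simpa using hz
    calc ‖f z‖ ≤ M := hM z hz'
      _ ≤ M' := le_max_left _ _
      _ = M' / (x * m) * x * m := by field_simp
      _ ≤ M' / (x * m) * x * ℓ ^ (z.re - 2) := mul_le_mul_of_nonneg_left (hlow z hz) (by positivity)
  -- induction on `x₁`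
  induction x₁ with
  | zero => exact ⟨0, le_rfl, fun x _ hx ↦ absurd hx (Nat.not_lt_zero _)⟩
  | succ x₁ ih =>
    obtain ⟨C₁, hC₁, h₁⟩ := ih
    by_cases hx₁ : 2 ≤ x₁
    · obtain ⟨C₂, hC₂, h₂⟩ := hone x₁ hx₁
      refine ⟨C₁ + C₂, by positivity, fun x hx2 hx z hz ↦ ?_⟩
      have hxpos : (0 : ℝ) < x := by exact_mod_cast (by omega : 0 < x)
      have hL2 : 0 ≤ (x : ℝ) * Real.log x ^ (z.re - 2) := by
        have hx1 : (1 : ℝ) ≤ x := by exact_mod_cast (show 1 ≤ x by omega)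
        have := Real.rpow_nonneg (Real.log_nonneg hx1) (z.re - 2)
        positivity
      rcases Nat.lt_succ_iff_lt_or_eq.1 hx with hlt | rfl
      · calc _ ≤ C₁ * x * Real.log x ^ (z.re - 2) := h₁ x hx2 hlt z hz
          _ ≤ (C₁ + C₂) * x * Real.log x ^ (z.re - 2) := by rw [mul_assoc, mul_assoc]; nlinarith
      · calc _ ≤ C₂ * x * Real.log x ^ (z.re - 2) := h₂ z hz
          _ ≤ (C₁ + C₂) * x * Real.log x ^ (z.re - 2) := by rw [mul_assoc, mul_assoc]; nlinarith
    · refine ⟨C₁, hC₁, fun x hx2 hx z hz ↦ h₁ x hx2 ?_ z hz⟩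
      omega

/-- **Selberg's mean value formula for `z^{ω(n)}`** (the hypothesis `hmv` of
`MontgomeryVaughan2007_exercise_7_4_3c_of_omegaMeanValue`, now PROVED): for every `R > 0` there
is `C` with `‖Σ_{n ≤ x} z^{ω(n)} − F_x(z)/Γ(z) · x (log x)^{z−1}‖ ≤ C x (log x)^{Re z − 2}` for all
integers `x ≥ 2` and `‖z‖ ≤ R`. [cite: MontgomeryVaughan2007, Theorem 7.18 and §7.4.1 Exercise 3(a),(b)] -/
theorem omegaMeanValue :
    ∀ R : ℝ, 0 < R → ∃ C : ℝ, ∀ x : ℕ, 2 ≤ x → ∀ z : ℂ, ‖z‖ ≤ R →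
      ‖(∑ n ∈ Finset.Icc 1 x, z ^ (ArithmeticFunction.cardDistinctFactors n)) -
          satheSelbergFC x z / Complex.Gamma z * (x : ℂ) * ((Real.log x : ℂ) ^ (z - 1))‖ ≤
        C * (x : ℝ) * Real.log x ^ (z.re - 2) := by
  intro R hR
  obtain ⟨C₁, hC₁, x₁, h₁⟩ := omegaMeanValue_large R hR
  obtain ⟨C₂, hC₂, h₂⟩ := omegaMeanValue_small R x₁
  refine ⟨C₁ + C₂, fun x hx2 z hz ↦ ?_⟩
  have hxpos : (0 : ℝ) < x := by exact_mod_cast (by omega : 0 < x)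
  have hL2 : 0 ≤ (x : ℝ) * Real.log x ^ (z.re - 2) := by
    have hx1 : (1 : ℝ) ≤ x := by exact_mod_cast (show 1 ≤ x by omega)
    have := Real.rpow_nonneg (Real.log_nonneg hx1) (z.re - 2)
    positivity
  rcases le_or_gt x₁ x with hx | hx
  · calc _ ≤ C₁ * x * Real.log x ^ (z.re - 2) := h₁ x hx z hz
      _ ≤ (C₁ + C₂) * x * Real.log x ^ (z.re - 2) := by rw [mul_assoc, mul_assoc]; nlinarith
  · calc _ ≤ C₂ * x * Real.log x ^ (z.re - 2) := h₂ x hx2 hx z hz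
      _ ≤ (C₁ + C₂) * x * Real.log x ^ (z.re - 2) := by rw [mul_assoc, mul_assoc]; nlinarith

end SatheSelberg

/-- **The Sathe–Selberg formula for `ω` — discharge of the named fact
`MontgomeryVaughan2007_exercise_7_4_3c`** (Montgomery–Vaughan 2007, §7.4.1 Exercise 3(c);
Selberg 1954): Selberg's mean value of `z^{ω(n)}` (`SatheSelberg.omegaMeanValue`, this file) fed
into the PROVED passage mean value ⇒ local laws
`MontgomeryVaughan2007_exercise_7_4_3c_of_omegaMeanValue` (`SatheSelbergProofs.lean`,
the Cauchy-integral/saddle-point argument of MV p. 180).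

Naming: the unprimed `MontgomeryVaughan2007_exercise_7_4_3c_holds` is declared (by an independent,
smoothed-sum proof) in `SatheSelbergSmoothedProof.lean`, which landed first; this second proof carries a
prime so that both modules can be imported together (e.g. by the umbrella `Literature`).
[cite: MontgomeryVaughan2007, §7.4.1 Exercise 3(c)] -/
theorem MontgomeryVaughan2007_exercise_7_4_3c_holds' : MontgomeryVaughan2007_exercise_7_4_3c :=
  MontgomeryVaughan2007_exercise_7_4_3c_of_omegaMeanValue SatheSelberg.omegaMeanValue

end Literature.NumberTheory.LFunctions
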